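import Literature.NumberTheory.LFunctions.BurnolInvZetaResidueSumProofs
import Literature.NumberTheory.LFunctions.BurnolScriptL1FourierProofs
import Literature.Analysis.FunctionSpaces.MellinPlancherelL2
import HarnessLib

/-!
# Burnol 2004b, Thm. 5.2 — the residue EXPANSION, pointwise conjunct (RH-FREE proofs; 0 defs, 0 facts)

Free-standing theorems towards the named fact `Burnol2004b_thm5_2` (`BurnolZetaSystemsHardy.lean`): the
POINTWISE conjunct — for every height sequence `(A, T)` of Prop. 5.1, every `g ∈ 𝓛₁` and every `Z ≠ 1`
with `ζ(Z) ≠ 0`, the Note-5 blocks of `S_n(Z) = Σ_{|Im ρ|<T_n} Res_{s=ρ}[G(s)/ζ(s)·ζ(Z)/(Z−s)]` are summable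
and `S_n(Z) → G(Z)` (`BurnolResidueSum.tendsto_burnolResiduePartialSum`). The `L²(½+iℝ)` conjuncts of the
fact are NOT proved here (they are the printed "absolute convergence in `L²`", TeX l.1052–1120).

## The printed proof followed (TeX l.1012–1050)

"We apply the calculus of residues to the contour integral around a rectangle with corners
`½ ± A ± iT_n` where `A ≥ 3/2` is chosen sufficiently large such that both `Z` and `1−Z` are in the open
rectangle … the contribution of the horizontal segments vanish as `n → ∞` … we obtain
`Σ_ρ … − G(Z) = (1/2π)(∫_{Re s = ½+A} − ∫_{Re s = ½−A}) ζ(Z)G(s)/((Z−s)ζ(s)) |ds|`. The functional equation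
`G(1−s)/ζ(1−s) = 𝓕₊(G)(s)/ζ(s)` reduces the case `Re s = ½ − A` to the case `Re s = ½ + A`. That last
integral does not change when we increase `A`. We note that the `L²`-norms of `G(s)` on `Re s = σ ≥ 2`
are uniformly bounded … Also `1/ζ(s) = O(1)` in `Re s ≥ 2`. The Cauchy–Schwarz inequality then shows that
the integral goes to `0` as `A → ∞`."  Here: rectangles `[1−b, b] × [−T_n, T_n]` with `b = 2K + 5/2`
(the left line `Re s = −2K − 3/2` misses the trivial zeros); the poles inside are the non-trivial zeros
(`BurnolResidueSum.rectBoundaryIntegral_eq_sum_residueAt`), `s = Z` (simple, residue `−G(Z)`) and the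
REMOVABLE points `s = 1`, `s = −2, …, −2K` (Lean's total `G/ζ` has the wrong value there; residue `0` by
the eventual identity `G(s)/ζ(s) = H(1−s)/ζ(1−s)`, `H = G_{𝓕g}`); horizontals are `O(T_n^{−2})` on
`−1 ≤ Re ≤ 2` (Prop. 5.1), on `2 ≤ Re ≤ b` (`|1/ζ| ≤ Σk^{−2}`, `𝓛₁` decay) and on `1−b ≤ Re ≤ −1` (the same
through the functional equation and Lemma 4.10, `Burnol2004b_lemma4_10_holds`); the independence of `b`
is free (the limit of `S_n(Z)` does not see `b`), and the vertical integrals are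
`≤ |ζ(Z)|·(Σk^{−2})·‖G(b+i·)‖_{L²}·‖1/(Z−b−i·)‖_{L²} → 0` with the UNIFORM bound
`‖G(b+i·)‖²_{L²} ≤ 2π|c|² + 4π‖g‖²` (`b ≥ 2`) from `G(s) = c/(1−s) + ∫_1^∞ g t^{−s}dt` and Mellin–Plancherel
(`MellinPlancherel.mellinL2`).

## References
- [Burnol2004b] J.-F. Burnol, *Two complete and minimal systems associated with the zeros of the
  Riemann zeta function*, JTNB 16 (2004) 65–94; arXiv:math/0203120v7 (dbl/src TeX), Thm. 5.2.
- [Titchmarsh1986] E. C. Titchmarsh, *The theory of the Riemann zeta-function*, 2nd ed., Thm. 9.7.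
-/

noncomputable section

open MeasureTheory Complex Filter Set Topology intervalIntegral

open scoped ComplexConjugate FourierTransform ENNReal Real

namespace Literature.NumberTheory.LFunctions

namespace BurnolResidueSum

open Literature.Analysis.Complex

/-! ## §1. The functional equation `G(s)/ζ(s) = H(1−s)/ζ(1−s)` off the lines -/

/-- **`G(s)/ζ(s) = H(1−s)/ζ(1−s)`**, `H = G_{𝓕g}`, for every `s ∉ {0,−2,−4,…} ∪ {1,3,5,…}` (the
functional equations `Λ(1−s) = Λ(s)` of `ζ` and `Γ_ℝ(s)G_{𝓕g}(s) = Γ_ℝ(1−s)G_g(1−s)` of `L_1`,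
Prop. 2.2 (v)): "The functional equation `G(1−s)/ζ(1−s) = 𝓕₊(G)(s)/ζ(s)`".
[cite: Burnol2004b, proof of Thm. 5.2 (arXiv:math/0203120v7 p. 12, TeX l.1032–1036)] -/
theorem div_zeta_eq_fourier_one_sub {g : Lp ℂ 2 (volume : Measure ℝ)} (hg : g ∈ sonineL 1) {s : ℂ}
    (h0 : ∀ n : ℕ, s ≠ -2 * (n : ℂ)) (h1 : ∀ n : ℕ, s ≠ 1 + 2 * (n : ℂ)) :
    rightMellinExt g s / riemannZeta s =
      rightMellinExt (𝓕 g : Lp ℂ 2 (volume : Measure ℝ)) (1 - s) / riemannZeta (1 - s) := by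
  set u : ℂ := 1 - s with hudef
  have hus : 1 - u = s := by rw [hudef]; ring
  have hu0 : ∀ n : ℕ, u ≠ -2 * (n : ℂ) := fun n h ↦ h1 n (by rw [← hus, h]; ring)
  have hu1 : ∀ n : ℕ, u ≠ 1 + 2 * (n : ℂ) := fun n h ↦ h0 n (by rw [← hus, h]; ring)
  have hFE := SonineLContinuation.rightMellinExt_functionalEquation_of_mem_sonineL one_pos hg u hu0 hu1
  rw [hus] at hFE
  have hs0 : s ≠ 0 := by simpa using h0 0
  have hu0' : u ≠ 0 := fun h ↦ h1 0 (by rw [← hus, h]; ring)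
  have hΛ : completedRiemannZeta s = completedRiemannZeta u := by
    rw [← hus]; exact completedRiemannZeta_one_sub u
  rw [riemannZeta_def_of_ne_zero hs0, riemannZeta_def_of_ne_zero hu0', div_div_eq_mul_div,
    div_div_eq_mul_div, hΛ, mul_comm (rightMellinExt (𝓕 g : Lp ℂ 2 (volume : Measure ℝ)) u), hFE,
    mul_comm]

/-- A non-real `s` satisfies the side conditions of `div_zeta_eq_fourier_one_sub`. [cite: Burnol2004b, proof of Thm. 5.2 (arXiv:math/0203120v7 p. 12, TeX l.1032–1036)] -/
theorem div_zeta_eq_fourier_one_sub_of_im_ne_zero {g : Lp ℂ 2 (volume : Measure ℝ)}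
    (hg : g ∈ sonineL 1) {s : ℂ} (hs : s.im ≠ 0) :
    rightMellinExt g s / riemannZeta s =
      rightMellinExt (𝓕 g : Lp ℂ 2 (volume : Measure ℝ)) (1 - s) / riemannZeta (1 - s) :=
  div_zeta_eq_fourier_one_sub hg (fun n h ↦ hs (by rw [h]; simp)) (fun n h ↦ hs (by rw [h]; simp))

/-! ## §2. Small tools: a simple pole, `1/ζ` on `Re s ≥ 2`, the zeros of `ζ` -/

/-- **`Res_{c} u(z)/(z − c) = u(c)`** for `u` analytic at `c` (copied road of the tree's
`residueAt_div_sub_self_of_analyticAt`, `RiemannSphereResidueTheorem.lean`, to keep imports light).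
[cite: Conway1978, §V.2 Prop. 2.4] -/
theorem residueAt_div_sub_self {u : ℂ → ℂ} {c : ℂ} (hu : AnalyticAt ℂ u c) :
    Literature.Analysis.Complex.residueAt (fun z ↦ u z / (z - c)) c = u c := by
  obtain ⟨p, hp⟩ := hu
  have hG : AnalyticAt ℂ (dslope u c) c := ⟨_, hp.has_fpower_series_dslope_fslope⟩
  have h := Literature.Analysis.Complex.residueAt_eq_of_principalPart (f := fun z ↦ u z / (z - c))
    (m := 1) (b := fun _ ↦ u c) hG ?_
  · rwa [if_pos one_pos] at h
  · filter_upwards [self_mem_nhdsWithin] with z hz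
    have hzc : z - c ≠ 0 := sub_ne_zero.2 hz
    simp only [Finset.sum_range_one, Nat.cast_zero, zero_add, zpow_neg, zpow_one]
    rw [dslope_of_ne _ hz, slope_def_field, div_eq_iff hzc, add_mul, div_mul_cancel₀ _ hzc,
      inv_mul_cancel_right₀ hzc]
    ring

/-- `‖1/ζ(s)‖ ≤ Σ_k k^{−2}` for `Re s ≥ 2` ("`1/ζ(s) = O(1)` in `Re s ≥ 2`").
[cite: Burnol2004b, proof of Thm. 5.2 (arXiv:math/0203120v7 p. 12, TeX l.1040–1041)] -/
theorem norm_inv_zeta_le_of_two_le_re {s : ℂ} (hs : 2 ≤ s.re) :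
    ‖(riemannZeta s)⁻¹‖ ≤ ∑' k : ℕ, (k : ℝ) ^ (-(2 : ℝ)) := by
  have hs1 : 1 < s.re := by linarith
  have hS : Summable fun k : ℕ ↦ (k : ℝ) ^ (-(2 : ℝ)) := Real.summable_nat_rpow.2 (by norm_num)
  have hb : ∀ k, ‖LSeries.term (fun n : ℕ ↦ ((ArithmeticFunction.moebius n : ℤ) : ℂ)) s k‖ ≤
      (k : ℝ) ^ (-(2 : ℝ)) := by
    intro k
    rcases Nat.eq_zero_or_pos k with rfl | hk
    · simp [Real.zero_rpow (show (-(2:ℝ)) ≠ 0 by norm_num)]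
    rw [LSeries.term_of_ne_zero hk.ne', norm_div, Complex.norm_natCast_cpow_of_pos hk]
    have hμ : ‖((ArithmeticFunction.moebius k : ℤ) : ℂ)‖ ≤ 1 := by
      rw [Complex.norm_intCast]
      exact_mod_cast ArithmeticFunction.abs_moebius_le_one
    calc ‖((ArithmeticFunction.moebius k : ℤ) : ℂ)‖ / (k : ℝ) ^ s.re ≤ 1 / (k : ℝ) ^ s.re := by
          gcongr
      _ = (k : ℝ) ^ (-s.re) := by rw [Real.rpow_neg (Nat.cast_nonneg k), one_div]
      _ ≤ (k : ℝ) ^ (-(2 : ℝ)) :=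
          Real.rpow_le_rpow_of_exponent_le (by exact_mod_cast hk) (by linarith)
  have hn : Summable fun k ↦ ‖LSeries.term (fun n : ℕ ↦ ((ArithmeticFunction.moebius n : ℤ) : ℂ))
      s k‖ := Summable.of_nonneg_of_le (fun _ ↦ norm_nonneg _) hb hS
  have hmul := LSeries_one_mul_Lseries_moebius hs1
  have hone : LSeries 1 s = riemannZeta s := LSeries_one_eq_riemannZeta hs1
  rw [hone] at hmul
  have hz : riemannZeta s ≠ 0 := riemannZeta_ne_zero_of_one_lt_re hs1
  rw [show (riemannZeta s)⁻¹ = LSeries (fun n : ℕ ↦ ((ArithmeticFunction.moebius n : ℤ) : ℂ)) s from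
    (eq_inv_of_mul_eq_one_right hmul).symm, LSeries]
  exact (norm_tsum_le_tsum_norm hn).trans (hn.tsum_le_tsum hb hS)

/-- A zero of `ζ` is a non-trivial zero or a trivial zero `−2(m+1)`. [folklore] -/
private theorem zero_dichotomy {z : ℂ} (h0 : riemannZeta z = 0) :
    z ∈ ZetaZeros.riemannZetaNontrivialZeros ∨ ∃ m : ℕ, z = -2 * ((m : ℂ) + 1) := by
  by_cases h : z ∈ Set.range (fun n : ℕ ↦ (-2 * (n + 1) : ℂ))
  · obtain ⟨m, hm⟩ := h
    exact Or.inr ⟨m, hm.symm⟩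
  · exact Or.inl ⟨h0, h⟩

/-- The non-trivial zeros below height `T` form a finite set. [folklore] -/
private theorem ntz_below_finite' (T : ℝ) :
    {ρ : ℂ | ρ ∈ ZetaZeros.riemannZetaNontrivialZeros ∧ |ρ.im| < T}.Finite := by
  refine (((isCompact_Icc (a := (0 : ℝ)) (b := 1)).reProdIm
    (isCompact_Icc (a := -T) (b := T))).inter_riemannZetaZeros_finite).subset ?_
  rintro ρ ⟨hρ, hT⟩
  have h := mem_riemannZetaNontrivialZeros_iff_holds.1 hρ
  exact ⟨Complex.mem_reProdIm.2 ⟨⟨h.2.1.le, h.2.2.le⟩, abs_lt.1 hT |>.imp le_of_lt le_of_lt⟩, h.1⟩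

/-! ## §4. `∫ dy/|Z − b − iy|² = π/(b − Re Z)` -/

/-- `∫_ℝ dy / ((b − Re Z)² + (y − Im Z)²) = π/(b − Re Z)` for `Re Z < b`, i.e.
`‖1/(Z − s)‖²_{L²(Re s = b)} = π/(b − Re Z)` — the quantity that "goes to `0` as `A → ∞`".
[cite: Burnol2004b, proof of Thm. 5.2 (arXiv:math/0203120v7 p. 12, TeX l.1041–1043)] -/
theorem integral_inv_normSq_sub_line {Z : ℂ} {b : ℝ} (hb : Z.re < b) :
    ∫ y : ℝ, (‖Z - (b + y * I)‖ ^ 2)⁻¹ = π / (b - Z.re) := by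
  have hd : 0 < b - Z.re := by linarith
  set d : ℝ := b - Z.re with hddef
  have hnorm : ∀ y : ℝ, ‖Z - (b + y * I)‖ ^ 2 = d ^ 2 * (1 + ((y - Z.im) / d) ^ 2) := by
    intro y
    rw [Complex.sq_norm, Complex.normSq_apply]
    simp only [sub_re, add_re, ofReal_re, mul_re, I_re, mul_zero, ofReal_im, I_im, mul_one, sub_self,
      add_zero, sub_im, add_im, mul_im, zero_add]
    field_simp
    rw [hddef]; ring
  simp_rw [hnorm, mul_inv]
  rw [MeasureTheory.integral_const_mul]
  have hsub : ∫ y : ℝ, (1 + ((y - Z.im) / d) ^ 2)⁻¹ = d * ∫ y : ℝ, (1 + y ^ 2)⁻¹ := by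
    have h1 : ∫ y : ℝ, (1 + ((y - Z.im) / d) ^ 2)⁻¹ = ∫ y : ℝ, (1 + (y / d) ^ 2)⁻¹ :=
      integral_sub_right_eq_self (fun y ↦ (1 + (y / d) ^ 2)⁻¹) Z.im
    rw [h1]
    have h2 := Measure.integral_comp_div (fun y : ℝ ↦ (1 + y ^ 2)⁻¹) d
    simp only [smul_eq_mul, abs_of_pos hd] at h2
    rw [h2]
  rw [hsub, integral_univ_inv_one_add_sq]
  field_simp

/-! ## §3. "The `L²`-norms of `G(s)` on `Re s = σ ≥ 2` are uniformly bounded" -/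

/-- `𝟙_{(1,∞)}(t)·t^{w−1} ∈ L²(ℝ)` for `Re w < 1/2`. [folklore] -/
private theorem memLp_indicator_cpow' {w : ℂ} (hw : w.re < 1 / 2) :
    MemLp (Set.indicator (Ioi (1 : ℝ)) (fun t : ℝ ↦ (t : ℂ) ^ (w - 1))) 2 volume := by
  have hmeas : Measurable (Set.indicator (Ioi (1 : ℝ)) (fun t : ℝ ↦ (t : ℂ) ^ (w - 1))) :=
    (Complex.measurable_ofReal.pow_const _).indicator measurableSet_Ioi
  rw [memLp_two_iff_integrable_sq_norm hmeas.aestronglyMeasurable]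
  have h1 : IntegrableOn (fun x : ℝ ↦ x ^ (2 * (w.re - 1))) (Ioi 1) :=
    integrableOn_Ioi_rpow_of_lt (by linarith) one_pos
  have h2 : Integrable (Set.indicator (Ioi (1 : ℝ)) (fun x : ℝ ↦ x ^ (2 * (w.re - 1)))) :=
    h1.integrable_indicator measurableSet_Ioi
  refine h2.congr (Eventually.of_forall fun x ↦ ?_)
  change _ = ‖Set.indicator (Ioi (1 : ℝ)) (fun t : ℝ ↦ (t : ℂ) ^ (w - 1)) x‖ ^ 2
  by_cases hx : x ∈ Ioi (1 : ℝ)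
  · have hx0 : (0 : ℝ) < x := lt_trans one_pos hx
    rw [Set.indicator_of_mem hx, Set.indicator_of_mem hx, Complex.norm_cpow_eq_rpow_re_of_pos hx0,
      ← Real.rpow_natCast, ← Real.rpow_mul hx0.le]
    congr 1
    simp; ring
  · rw [Set.indicator_of_notMem hx, Set.indicator_of_notMem hx]; simp

section LineL2

variable {h : Lp ℂ 2 (volume : Measure ℝ)} (hh : h ∈ sonineL 1) {c : ℂ}
  (hc : ∀ᵐ x : ℝ, x ∈ Ioo (0 : ℝ) 1 → h x = c) (h₁ : Lp ℂ 2 (volume : Measure ℝ))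
  (hh₁ : ∀ᵐ x : ℝ, h₁ x = Set.indicator {x : ℝ | 1 < |x|} (h : ℝ → ℂ) x)

include hh₁ in
/-- `t^{w−1}·(𝟙_{|x|>1}h)(t)` is integrable on `(0,∞)` for `Re w < 1/2` (Cauchy–Schwarz). [folklore] -/
private theorem integrableOn_cpow_smul_trunc' {w : ℂ} (hw : w.re < 1 / 2) :
    IntegrableOn (fun t : ℝ ↦ (t : ℂ) ^ (w - 1) • (h₁ : ℝ → ℂ) t) (Ioi 0) := by
  have h1 : Integrable (fun x ↦ (h₁ : ℝ → ℂ) x *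
      Set.indicator (Ioi (1 : ℝ)) (fun t : ℝ ↦ (t : ℂ) ^ (w - 1)) x) :=
    (Lp.memLp h₁).integrable_mul (memLp_indicator_cpow' hw)
  refine (h1.integrableOn (s := Ioi 0)).congr_fun_ae ?_
  filter_upwards [ae_restrict_mem measurableSet_Ioi, ae_restrict_of_ae (s := Ioi 0) hh₁] with x hx hgx
  have hx' : (0 : ℝ) < x := hx
  by_cases hxa : (1 : ℝ) < x
  · rw [Set.indicator_of_mem (show x ∈ Ioi (1 : ℝ) from hxa), smul_eq_mul, mul_comm]
  · rw [Set.indicator_of_notMem (show x ∉ Ioi (1 : ℝ) from hxa), hgx, Set.indicator_of_notMem]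
    · simp
    · simp only [mem_setOf_eq, not_lt]
      rw [abs_of_pos hx']
      exact not_lt.1 hxa

include hh₁ in
/-- The weighted truncation `t^{1/2−b}(𝟙_{|x|>1}h)(t)` is dominated by `|h₁|` on `(0,∞)` (`b ≥ 1/2`).
[folklore] -/
private theorem norm_weight_mul_le {b : ℝ} (hb : 1 / 2 ≤ b) :
    ∀ᵐ t : ℝ ∂(volume.restrict (Ioi (0 : ℝ))),
      ‖((t : ℝ) : ℂ) ^ (((1 / 2 - b : ℝ)) : ℂ) * (h₁ : ℝ → ℂ) t‖ ≤ 1 * ‖(h₁ : ℝ → ℂ) t‖ := by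
  filter_upwards [ae_restrict_mem measurableSet_Ioi, ae_restrict_of_ae (s := Ioi 0) hh₁] with t ht hgt
  have ht' : (0 : ℝ) < t := ht
  rw [norm_mul, one_mul]
  by_cases hta : (1 : ℝ) < t
  · have : ‖(t : ℂ) ^ (((1 / 2 - b : ℝ)) : ℂ)‖ ≤ 1 := by
      rw [Complex.norm_cpow_eq_rpow_re_of_pos ht', ofReal_re]
      exact Real.rpow_le_one_of_one_le_of_nonpos hta.le (by linarith)
    exact mul_le_of_le_one_left (norm_nonneg _) this
  · rw [hgt, Set.indicator_of_notMem]
    · simp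
    · simp only [mem_setOf_eq, not_lt]
      rw [abs_of_pos ht']
      exact not_lt.1 hta

include hh₁ in
/-- `t^{1/2−b}(𝟙_{|x|>1}h)(t) ∈ L²(0,∞)`. [folklore] -/
private theorem memLp_weight_mul {b : ℝ} (hb : 1 / 2 ≤ b) :
    MemLp (fun t : ℝ ↦ (t : ℂ) ^ (((1 / 2 - b : ℝ)) : ℂ) * (h₁ : ℝ → ℂ) t) 2
      (volume.restrict (Ioi (0 : ℝ))) := by
  refine MemLp.of_le_mul ((Lp.memLp h₁).restrict (Ioi 0)) ?_ (norm_weight_mul_le h₁ hh₁ hb)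
  exact ((Complex.measurable_ofReal.pow_const _).aestronglyMeasurable.mul
    (Lp.aestronglyMeasurable h₁).restrict)

include hh₁ in
/-- The Mellin transform of the weighted truncation converges absolutely on the critical line
(`b > 1/2`… here `b ≥ 2`). [folklore] -/
private theorem mellinConvergent_weight_mul {b : ℝ} (hb : 1 < b) :
    MellinConvergent (fun t : ℝ ↦ (t : ℂ) ^ (((1 / 2 - b : ℝ)) : ℂ) * (h₁ : ℝ → ℂ) t) (1 / 2 : ℂ) := by
  have h0 := integrableOn_cpow_smul_trunc' h₁ hh₁ (w := ((1 - b : ℝ) : ℂ)) (by simp; linarith)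
  refine h0.congr_fun_ae ?_
  filter_upwards [ae_restrict_mem measurableSet_Ioi] with t ht
  have ht0 : (t : ℂ) ≠ 0 := ofReal_ne_zero.2 (ne_of_gt ht)
  simp only [smul_eq_mul]
  rw [← mul_assoc, ← Complex.cpow_add _ _ ht0]
  congr 2
  push_cast; ring

/-- `mellin (t^{1/2−b} h₁) (1/2 + w) = mellin h₁ (1 − b + w)`. [folklore] -/
private theorem mellin_weight_mul (b : ℝ) (w : ℂ) :
    mellin (fun t : ℝ ↦ (t : ℂ) ^ (((1 / 2 - b : ℝ)) : ℂ) * (h₁ : ℝ → ℂ) t) (1 / 2 + w) =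
      mellin (h₁ : ℝ → ℂ) (1 - b + w) := by
  refine setIntegral_congr_fun measurableSet_Ioi fun t ht ↦ ?_
  have ht0 : (t : ℂ) ≠ 0 := ofReal_ne_zero.2 (ne_of_gt ht)
  simp only [smul_eq_mul]
  rw [← mul_assoc, ← Complex.cpow_add _ _ ht0]
  congr 2
  push_cast; ring

include hh₁ in
/-- **Plancherel on the line `Re s = b`** for the truncated part `∫_1^∞ h(t)t^{−s}dt = 𝓜h₁(1−s)`:
`∫_ℝ |𝓜h₁(1−b−iy)|² dy ≤ 2π‖h₁‖²` (`b > 1`), by `MellinL2.mellinL2_toLp_ae_eq_mellin` applied to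
`t^{1/2−b}h₁(t)`. [cite: Burnol2004b, proof of Thm. 5.2 (arXiv:math/0203120v7 p. 12, TeX l.1037–1040)] -/
theorem integral_norm_sq_mellin_trunc_line_le {b : ℝ} (hb : 1 < b) :
    Integrable (fun y : ℝ ↦ ‖mellin (h₁ : ℝ → ℂ) (1 - b - y * I)‖ ^ 2) ∧
    ∫ y : ℝ, ‖mellin (h₁ : ℝ → ℂ) (1 - b - y * I)‖ ^ 2 ≤ 2 * π * ‖h₁‖ ^ 2 := by
  have hf2 := memLp_weight_mul h₁ hh₁ (b := b) (by linarith)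
  have hf1 := mellinConvergent_weight_mul h₁ hh₁ hb
  have hae := Literature.Analysis.FunctionSpaces.MellinL2.mellinL2_toLp_ae_eq_mellin hf2 hf1
  set F : Lp ℂ 2 (volume.restrict (Ioi (0 : ℝ))) := hf2.toLp _ with hFdef
  -- `ψ' ξ := |𝓜h₁(1 − b + 2πiξ)|²` agrees a.e. with `|𝓜F(ξ)|²`
  set ψ : ℝ → ℝ := fun ξ ↦ ‖(Literature.Analysis.FunctionSpaces.MellinL2.mellinL2 F : ℝ → ℂ) ξ‖ ^ 2
    with hψ
  set ψ' : ℝ → ℝ := fun ξ ↦ ‖mellin (h₁ : ℝ → ℂ) (1 - b + 2 * π * ξ * I)‖ ^ 2 with hψ'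
  have hψψ' : ψ =ᵐ[volume] ψ' := by
    filter_upwards [hae] with ξ hξ
    simp only [hψ, hψ']
    rw [hξ, mellin_weight_mul]
  have hψi : Integrable ψ :=
    (memLp_two_iff_integrable_sq_norm (Lp.aestronglyMeasurable _)).1 (Lp.memLp _)
  have hψ'i : Integrable ψ' := hψi.congr hψψ'
  -- `∫ ψ ≤ ‖h₁‖²`
  have hψle : ∫ ξ, ψ ξ ≤ ‖h₁‖ ^ 2 := by
    rw [hψ]
    simp only
    rw [Literature.Analysis.FunctionSpaces.MellinL2.integral_norm_sq_mellinL2]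
    have h1 : ∫ t in Ioi (0 : ℝ), ‖(F : ℝ → ℂ) t‖ ^ 2 =
        ∫ t in Ioi (0 : ℝ), ‖(t : ℂ) ^ (((1 / 2 - b : ℝ)) : ℂ) * (h₁ : ℝ → ℂ) t‖ ^ 2 := by
      refine integral_congr_ae ?_
      filter_upwards [hf2.coeFn_toLp] with t ht
      rw [ht]
    rw [h1, ← Literature.Analysis.FunctionSpaces.MellinL2.integral_norm_sq_eq_norm_sq h₁]
    have hi2 : Integrable (fun t : ℝ ↦ ‖(h₁ : ℝ → ℂ) t‖ ^ 2) :=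
      (memLp_two_iff_integrable_sq_norm (Lp.aestronglyMeasurable _)).1 (Lp.memLp _)
    calc ∫ t in Ioi (0 : ℝ), ‖(t : ℂ) ^ (((1 / 2 - b : ℝ)) : ℂ) * (h₁ : ℝ → ℂ) t‖ ^ 2
        ≤ ∫ t in Ioi (0 : ℝ), ‖(h₁ : ℝ → ℂ) t‖ ^ 2 := by
          refine integral_mono_of_nonneg (Eventually.of_forall fun t ↦ by positivity) hi2.integrableOn ?_
          filter_upwards [norm_weight_mul_le h₁ hh₁ (b := b) (by linarith)] with t ht
          rw [one_mul] at ht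
          exact pow_le_pow_left₀ (norm_nonneg _) ht 2
      _ ≤ ∫ t, ‖(h₁ : ℝ → ℂ) t‖ ^ 2 :=
          setIntegral_le_integral hi2 (Eventually.of_forall fun t ↦ by positivity)
  -- the substitution `y = −2πξ`
  have hsub : (fun y : ℝ ↦ ‖mellin (h₁ : ℝ → ℂ) (1 - b - y * I)‖ ^ 2) =
      fun y : ℝ ↦ ψ' ((-1 / (2 * π)) * y) := by
    funext y
    simp only [hψ']
    congr 3
    push_cast
    field_simp
    ring
  have hR : (-1 / (2 * π) : ℝ) ≠ 0 := by
    have := Real.pi_pos; apply div_ne_zero (by norm_num); positivity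
  refine ⟨by rw [hsub]; exact hψ'i.comp_mul_left' hR, ?_⟩
  rw [hsub, Measure.integral_comp_mul_left ψ' (-1 / (2 * π))]
  have habs : |(-1 / (2 * π) : ℝ)⁻¹| = 2 * π := by
    rw [inv_div, abs_div, abs_neg, abs_one, div_one, abs_of_pos (by positivity)]
  rw [habs, smul_eq_mul, integral_congr_ae hψψ'.symm]
  have : 0 < π := Real.pi_pos
  nlinarith [hψle]

include hh hc hh₁ in
/-- **"The `L²`-norms of `G(s)` on `Re s = σ ≥ 2` are uniformly bounded"**: for `h ∈ L_1` with
`h = c` on `(0,1)` and every `b ≥ 2`, `y ↦ G_h(b+iy)` is in `L²(ℝ)` with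
`∫|G_h(b+iy)|²dy ≤ 2π|c|² + 4π‖h₁‖²` (`G_h(s) = c/(1−s) + 𝓜h₁(1−s)`, `h₁ = 𝟙_{|x|>1}h`).
[cite: Burnol2004b, proof of Thm. 5.2 (arXiv:math/0203120v7 p. 12, TeX l.1037–1040)] -/
theorem memLp_line_and_integral_norm_sq_le {b : ℝ} (hb : 2 ≤ b) :
    MemLp (fun y : ℝ ↦ rightMellinExt h (b + y * I)) 2 volume ∧
    ∫ y : ℝ, ‖rightMellinExt h (b + y * I)‖ ^ 2 ≤ 2 * π * ‖c‖ ^ 2 + 4 * π * ‖h₁‖ ^ 2 := by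
  set α : ℝ → ℂ := fun y ↦ c / (1 - (b + y * I)) with hα
  set β : ℝ → ℂ := fun y ↦ mellin (h₁ : ℝ → ℂ) (1 - b - y * I) with hβ
  have hG : (fun y : ℝ ↦ rightMellinExt h (b + y * I)) = fun y ↦ α y + β y := by
    funext y
    rw [rightMellinExt_eq_of_half_lt_re h h₁ hh₁ hh hc (s := b + y * I) (by simp; linarith)
      (fun h1 ↦ by have := congrArg Complex.re h1; simp at this; linarith)]
    simp only [hα, hβ]
    congr 2; ring
  -- Part A: `c/(1 − s)`
  have hαn : ∀ y : ℝ, ‖α y‖ ^ 2 = ‖c‖ ^ 2 * (‖(1 : ℂ) - (b + y * I)‖ ^ 2)⁻¹ := by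
    intro y; rw [hα]; simp only; rw [norm_div, div_pow, div_eq_mul_inv]
  have hαI : ∫ y : ℝ, ‖α y‖ ^ 2 = ‖c‖ ^ 2 * (π / (b - 1)) := by
    simp_rw [hαn]
    rw [MeasureTheory.integral_const_mul]
    have := integral_inv_normSq_sub_line (Z := 1) (b := b) (by simp; linarith)
    simp only [one_re] at this
    rw [this]
  have hαc : Continuous α := by
    refine Continuous.div continuous_const (by fun_prop) fun y h0 ↦ ?_
    have := congrArg Complex.re h0; simp at this; linarith
  have hαint : Integrable fun y : ℝ ↦ ‖α y‖ ^ 2 := by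
    have hk : Integrable fun y : ℝ ↦ (‖(1 : ℂ) - (b + y * I)‖ ^ 2)⁻¹ := by
      by_contra hni
      have h0 := integral_undef hni
      have := integral_inv_normSq_sub_line (Z := 1) (b := b) (by simp; linarith)
      rw [h0] at this
      simp only [one_re] at this
      have : 0 < π / (b - 1) := div_pos Real.pi_pos (by linarith)
      linarith
    simpa [hαn] using hk.const_mul (‖c‖ ^ 2)
  have hαm : MemLp α 2 volume :=
    (memLp_two_iff_integrable_sq_norm hαc.aestronglyMeasurable).2 hαint
  -- Part B: `𝓜h₁(1 − s)`
  obtain ⟨hβint, hβI⟩ := integral_norm_sq_mellin_trunc_line_le h₁ hh₁ (b := b) (by linarith)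
  have hβc : Continuous β := by
    have hd := differentiableOn_mellin_trunc_one_sub h h₁ hh₁
    have hc' : Continuous fun y : ℝ ↦ mellin (h₁ : ℝ → ℂ) (1 - ((b : ℂ) + y * I)) :=
      hd.continuousOn.comp_continuous (f := fun y : ℝ ↦ (b : ℂ) + y * I) (by fun_prop)
        fun y ↦ by simp; linarith
    refine hc'.congr fun y ↦ ?_
    simp only [hβ]; congr 1; ring
  have hβm : MemLp β 2 volume :=
    (memLp_two_iff_integrable_sq_norm hβc.aestronglyMeasurable).2 hβint
  have hsum : MemLp (fun y ↦ α y + β y) 2 volume := hαm.add hβm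
  refine ⟨by rw [hG]; exact hsum, ?_⟩
  have hG' : ∀ y : ℝ, rightMellinExt h (b + y * I) = α y + β y := fun y ↦ congrFun hG y
  simp_rw [hG']
  have hi : Integrable fun y : ℝ ↦ ‖α y + β y‖ ^ 2 :=
    (memLp_two_iff_integrable_sq_norm hsum.aestronglyMeasurable).1 hsum
  have hβint' : Integrable fun y : ℝ ↦ ‖β y‖ ^ 2 := hβint
  have hβI' : ∫ y : ℝ, ‖β y‖ ^ 2 ≤ 2 * π * ‖h₁‖ ^ 2 := hβI
  calc ∫ y : ℝ, ‖α y + β y‖ ^ 2 ≤ ∫ y : ℝ, (2 * ‖α y‖ ^ 2 + 2 * ‖β y‖ ^ 2) := by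
        refine integral_mono hi ((hαint.const_mul 2).add (hβint'.const_mul 2)) fun y ↦ ?_
        have h0 := norm_add_le (α y) (β y)
        have h1 : ‖α y + β y‖ ^ 2 ≤ (‖α y‖ + ‖β y‖) ^ 2 := pow_le_pow_left₀ (norm_nonneg _) h0 2
        nlinarith [sq_nonneg (‖α y‖ - ‖β y‖)]
    _ = 2 * (∫ y : ℝ, ‖α y‖ ^ 2) + 2 * (∫ y : ℝ, ‖β y‖ ^ 2) := by
        rw [integral_add (hαint.const_mul 2) (hβint'.const_mul 2), MeasureTheory.integral_const_mul,
          MeasureTheory.integral_const_mul]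
    _ ≤ 2 * (‖c‖ ^ 2 * π) + 2 * (2 * π * ‖h₁‖ ^ 2) := by
        rw [hαI]
        have h1 : (b - 1)⁻¹ ≤ 1 := inv_le_one_of_one_le₀ (by linarith)
        have h2 : ‖c‖ ^ 2 * (π / (b - 1)) ≤ ‖c‖ ^ 2 * π := by
          rw [div_eq_mul_inv]
          calc ‖c‖ ^ 2 * (π * (b - 1)⁻¹) ≤ ‖c‖ ^ 2 * (π * 1) := by gcongr
            _ = ‖c‖ ^ 2 * π := by ring
        linarith
    _ = 2 * π * ‖c‖ ^ 2 + 4 * π * ‖h₁‖ ^ 2 := by ring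

include hh hc hh₁ in
/-- **The vertical-line estimate** ("The Cauchy–Schwarz inequality then shows that the integral goes to
`0` as `A → ∞`"): for `b ≥ 2`, `Re W < b` and any constant `κ`,
`‖∫ G_h(b+iy)/ζ(b+iy)·κ/(W − b − iy) dy‖ ≤ ‖κ‖·(Σk^{−2})·(2π|c|² + 4π‖h₁‖²)^{1/2}·(π/(b − Re W))^{1/2}`.
[cite: Burnol2004b, proof of Thm. 5.2 (arXiv:math/0203120v7 p. 12, TeX l.1037–1043)] -/
theorem norm_integral_vertical_le {b : ℝ} (hb : 2 ≤ b) {W : ℂ} (hW : W.re < b) (κ : ℂ) :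
    ‖∫ y : ℝ, rightMellinExt h (b + y * I) / riemannZeta (b + y * I) * (κ / (W - (b + y * I)))‖ ≤
      ‖κ‖ * (∑' k : ℕ, (k : ℝ) ^ (-(2 : ℝ))) *
        ((2 * π * ‖c‖ ^ 2 + 4 * π * ‖h₁‖ ^ 2) ^ (1 / 2 : ℝ) * (π / (b - W.re)) ^ (1 / 2 : ℝ)) := by
  set B : ℝ := ∑' k : ℕ, (k : ℝ) ^ (-(2 : ℝ)) with hBdef
  set M : ℝ := 2 * π * ‖c‖ ^ 2 + 4 * π * ‖h₁‖ ^ 2 with hMdef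
  obtain ⟨hGm, hGI⟩ := memLp_line_and_integral_norm_sq_le hh hc h₁ hh₁ hb
  set u : ℝ → ℝ := fun y ↦ ‖rightMellinExt h (b + y * I)‖ with hu
  set k : ℝ → ℝ := fun y ↦ ‖W - (b + y * I)‖⁻¹ with hk
  have hB0 : 0 ≤ B := tsum_nonneg fun n ↦ Real.rpow_nonneg (Nat.cast_nonneg n) _
  have hWs : ∀ y : ℝ, W - (b + y * I) ≠ 0 := fun y h0 ↦ by
    have := congrArg Complex.re h0; simp at this; linarith
  -- pointwise bound of the integrand
  have hpt : ∀ y : ℝ, ‖rightMellinExt h (b + y * I) / riemannZeta (b + y * I) * (κ / (W - (b + y * I)))‖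
      ≤ ‖κ‖ * B * (u y * k y) := by
    intro y
    rw [norm_mul, norm_div, norm_div, hu, hk]
    simp only
    have hz := norm_inv_zeta_le_of_two_le_re (s := b + y * I) (by simp; linarith)
    rw [norm_inv] at hz
    have h1 : ‖rightMellinExt h (b + y * I)‖ / ‖riemannZeta (b + y * I)‖ ≤
        ‖rightMellinExt h (b + y * I)‖ * B := by
      rw [div_eq_mul_inv]; gcongr
    calc _ ≤ (‖rightMellinExt h (b + y * I)‖ * B) * (‖κ‖ / ‖W - (b + y * I)‖) := by gcongr
      _ = ‖κ‖ * B * (‖rightMellinExt h (b + y * I)‖ * ‖W - (b + y * I)‖⁻¹) := by ring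
  -- `k ∈ L²`
  have hkc : Continuous k := by
    refine Continuous.inv₀ (by fun_prop) fun y ↦ ?_
    exact (norm_pos_iff.2 (hWs y)).ne'
  have hk2 : ∫ y : ℝ, k y ^ 2 = π / (b - W.re) := by
    simp only [hk, inv_pow]
    exact integral_inv_normSq_sub_line hW
  have hkint : Integrable fun y : ℝ ↦ k y ^ 2 := by
    by_contra hni
    have h0 := integral_undef hni
    rw [hk2] at h0
    have : 0 < π / (b - W.re) := div_pos Real.pi_pos (by linarith)
    linarith
  have hkm2 : MemLp k 2 volume := by
    rw [memLp_two_iff_integrable_sq_norm hkc.aestronglyMeasurable]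
    refine hkint.congr (Eventually.of_forall fun y ↦ ?_)
    simp [hk]
  have hum2 : MemLp u 2 volume := hGm.norm
  have h22 : ENNReal.ofReal 2 = 2 := by norm_num
  have hkm : MemLp k (ENNReal.ofReal 2) volume := by rw [h22]; exact hkm2
  have hum : MemLp u (ENNReal.ofReal 2) volume := by rw [h22]; exact hum2
  -- Hölder
  have hH := integral_mul_le_Lp_mul_Lq_of_nonneg Real.HolderConjugate.two_two
    (Eventually.of_forall fun y ↦ norm_nonneg _) (Eventually.of_forall fun y ↦ by positivity) hum hkm
  have hu2 : ∫ y : ℝ, u y ^ (2 : ℝ) ≤ M := by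
    have : ∫ y : ℝ, u y ^ (2 : ℝ) = ∫ y : ℝ, ‖rightMellinExt h (b + y * I)‖ ^ 2 := by
      refine integral_congr_ae (Eventually.of_forall fun y ↦ ?_)
      simp [hu]
    rw [this]; exact hGI
  have hk2' : ∫ y : ℝ, k y ^ (2 : ℝ) = π / (b - W.re) := by
    rw [← hk2]
    refine integral_congr_ae (Eventually.of_forall fun y ↦ ?_)
    simp
  have hprod : ∫ y : ℝ, u y * k y ≤ M ^ (1 / 2 : ℝ) * (π / (b - W.re)) ^ (1 / 2 : ℝ) := by
    refine hH.trans ?_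
    rw [hk2']
    gcongr
  -- assemble
  have hint : Integrable fun y : ℝ ↦ ‖κ‖ * B * (u y * k y) :=
    ((hum2.integrable_mul hkm2).const_mul _)
  calc ‖∫ y : ℝ, rightMellinExt h (b + y * I) / riemannZeta (b + y * I) * (κ / (W - (b + y * I)))‖
      ≤ ∫ y : ℝ, ‖rightMellinExt h (b + y * I) / riemannZeta (b + y * I) * (κ / (W - (b + y * I)))‖ :=
        norm_integral_le_integral_norm _
    _ ≤ ∫ y : ℝ, ‖κ‖ * B * (u y * k y) :=
        integral_mono_of_nonneg (Eventually.of_forall fun y ↦ norm_nonneg _) hint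
          (Eventually.of_forall hpt)
    _ = ‖κ‖ * B * ∫ y : ℝ, u y * k y := MeasureTheory.integral_const_mul _ _
    _ ≤ ‖κ‖ * B * (M ^ (1 / 2 : ℝ) * (π / (b - W.re)) ^ (1 / 2 : ℝ)) := by gcongr

end LineL2

/-! ## §5. The pointwise residue expansion -/

/-- A continuous function on `ℝ` dominated by `C/(1+y²)` is integrable. [folklore] -/
private theorem integrable_of_norm_le_div_one_add_sq' {φ : ℝ → ℂ} (hφ : Continuous φ) {C : ℝ}
    (h : ∀ y, ‖φ y‖ ≤ C / (1 + y ^ 2)) : Integrable φ := by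
  refine Integrable.mono' ((integrable_inv_one_add_sq).const_mul C) hφ.aestronglyMeasurable
    (Eventually.of_forall fun y ↦ ?_)
  simpa [div_eq_mul_inv] using h y

/-- Continuity of `y ↦ G(σ + iy)` on a line `σ ≠ 1`. [folklore] -/
private theorem continuous_rightMellinExt_line' {g : Lp ℂ 2 (volume : Measure ℝ)}
    (hg : g ∈ sonineL 1) {σ : ℝ} (hσ : σ ≠ 1) :
    Continuous fun y : ℝ ↦ rightMellinExt g (σ + y * I) := by
  refine continuous_iff_continuousAt.2 fun y ↦ ?_
  have hne : (σ : ℂ) + y * I ≠ 1 := fun h ↦ hσ (by simpa using congrArg Complex.re h)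
  exact (differentiableAt_rightMellinExt hg hne).continuousAt.comp
    (f := fun y : ℝ ↦ (σ : ℂ) + y * I) (x := y) (by fun_prop)

/-- `G` is integrable along every vertical line `σ ≠ 1` (`g ∈ 𝓛₁`). [folklore] -/
private theorem integrable_rightMellinExt_line {g : Lp ℂ 2 (volume : Measure ℝ)}
    (hg : g ∈ burnolScriptL1) {σ : ℝ} (hσ : σ ≠ 1) :
    Integrable fun y : ℝ ↦ rightMellinExt g (σ + y * I) := by
  obtain ⟨C, hC⟩ := exists_norm_line_le_of_mem_scriptL1 hg hσ
  exact integrable_of_norm_le_div_one_add_sq' (continuous_rightMellinExt_line' hg.1 hσ) hC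

/-- **Removable points**: if `F` agrees near `p` (off `p`) with a function analytic at `p`, then
`F` is differentiable on a punctured open neighbourhood of `p`, meromorphic at `p`, with residue `0`.
[folklore] -/
private theorem removable_pack {F Ψ : ℂ → ℂ} {p : ℂ} (hΨ : AnalyticAt ℂ Ψ p)
    (hF : F =ᶠ[𝓝[≠] p] Ψ) :
    (∃ V : Set ℂ, IsOpen V ∧ p ∈ V ∧ ∀ z ∈ V, z ≠ p → DifferentiableAt ℂ F z) ∧
      MeromorphicAt F p ∧ Literature.Analysis.Complex.residueAt F p = 0 := by
  have hev : ∀ᶠ z in 𝓝 p, (z ≠ p → F z = Ψ z) ∧ AnalyticAt ℂ Ψ z :=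
    (eventually_nhdsWithin_iff.1 hF).and hΨ.eventually_analyticAt
  obtain ⟨V, hVsub, hVo, hpV⟩ := mem_nhds_iff.1 hev
  refine ⟨⟨V, hVo, hpV, fun z hz hzp ↦ ?_⟩, hΨ.meromorphicAt.congr hF.symm, ?_⟩
  · have hev' : F =ᶠ[𝓝 z] Ψ := by
      filter_upwards [hVo.mem_nhds hz, isOpen_ne.mem_nhds hzp] with w hw hw1
      exact (hVsub hw).1 hw1
    exact (hVsub hz).2.differentiableAt.congr_of_eventuallyEq hev'
  · have hΨd : ∀ᶠ z in 𝓝[≠] p, DifferentiableAt ℂ Ψ z :=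
      (hΨ.eventually_analyticAt.filter_mono nhdsWithin_le_nhds).mono fun z hz ↦ hz.differentiableAt
    rw [Literature.Analysis.Complex.residueAt_congr hΨd hF.symm]
    exact Literature.Analysis.Complex.residueAt_of_analyticAt hΨ

/-- **Telescoping bound ⇒ summable.** [folklore] -/
private theorem summable_sub_of_monotone_bounded' {a : ℕ → ℝ} (hmono : Monotone a) {B : ℝ}
    (hB : ∀ n, a n ≤ B) : Summable fun n ↦ a (n + 1) - a n := by
  refine summable_of_sum_range_le (c := B - a 0) (fun n ↦ sub_nonneg.2 (hmono (Nat.le_succ n))) fun n ↦ ?_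
  rw [Finset.sum_range_sub]
  linarith [hB n]

/-- The increment of symmetric interval integrals is bounded by the increment of the integrals of
the norm. [folklore] -/
private theorem norm_intervalIntegral_sub_le' {φ : ℝ → ℂ} (hφ : Integrable φ) {T T' : ℝ} (hTT' : T ≤ T') :
    ‖(∫ y in (-T')..T', φ y) - ∫ y in (-T)..T, φ y‖ ≤
      (∫ y in (-T')..T', ‖φ y‖) - ∫ y in (-T)..T, ‖φ y‖ := by
  have hi : ∀ a b : ℝ, IntervalIntegrable φ volume a b := fun a b ↦ hφ.intervalIntegrable
  have hin : ∀ a b : ℝ, IntervalIntegrable (fun y ↦ ‖φ y‖) volume a b := fun a b ↦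
    hφ.norm.intervalIntegrable
  have e1 : ∫ y in (-T')..T', φ y =
      (∫ y in (-T')..(-T), φ y) + ((∫ y in (-T)..T, φ y) + ∫ y in T..T', φ y) := by
    rw [intervalIntegral.integral_add_adjacent_intervals (hi _ _) (hi _ _),
      intervalIntegral.integral_add_adjacent_intervals (hi _ _) (hi _ _)]
  have e2 : ∫ y in (-T')..T', ‖φ y‖ =
      (∫ y in (-T')..(-T), ‖φ y‖) + ((∫ y in (-T)..T, ‖φ y‖) + ∫ y in T..T', ‖φ y‖) := by
    rw [intervalIntegral.integral_add_adjacent_intervals (hin _ _) (hin _ _),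
      intervalIntegral.integral_add_adjacent_intervals (hin _ _) (hin _ _)]
  rw [e1, e2]
  have h1 := intervalIntegral.norm_integral_le_integral_norm (f := φ) (μ := volume)
    (neg_le_neg hTT' : -T' ≤ -T)
  have h2 := intervalIntegral.norm_integral_le_integral_norm (f := φ) (μ := volume) hTT'
  calc ‖(∫ y in (-T')..(-T), φ y) + ((∫ y in (-T)..T, φ y) + ∫ y in T..T', φ y) - ∫ y in (-T)..T, φ y‖
      = ‖(∫ y in (-T')..(-T), φ y) + ∫ y in T..T', φ y‖ := by ring_nf
    _ ≤ ‖∫ y in (-T')..(-T), φ y‖ + ‖∫ y in T..T', φ y‖ := norm_add_le _ _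
    _ ≤ (∫ y in (-T')..(-T), ‖φ y‖) + ∫ y in T..T', ‖φ y‖ := add_le_add h1 h2
    _ = _ := by ring

/-- Continuity and boundedness of the multiplier `y ↦ ζ(b+iy)^{-1}·κ/(W − b − iy)` on a line `b ≥ 2`,
`Re W < b`. [folklore] -/
private theorem multiplier_cont_bdd {b : ℝ} (hb : 2 ≤ b) {W : ℂ} (hW : W.re < b) (κ : ℂ) :
    Continuous (fun y : ℝ ↦ (riemannZeta (b + y * I))⁻¹ * (κ / (W - (b + y * I)))) ∧
    ∀ y : ℝ, ‖(riemannZeta (b + y * I))⁻¹ * (κ / (W - (b + y * I)))‖ ≤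
      (∑' k : ℕ, (k : ℝ) ^ (-(2 : ℝ))) * (‖κ‖ / (b - W.re)) := by
  have hWs : ∀ y : ℝ, W - (b + y * I) ≠ 0 := fun y h0 ↦ by
    have := congrArg Complex.re h0; simp at this; linarith
  refine ⟨continuous_iff_continuousAt.2 fun y ↦ ?_, fun y ↦ ?_⟩
  · have hne1 : (b : ℂ) + y * I ≠ 1 := fun h ↦ by
      have := congrArg Complex.re h; simp at this; linarith
    have hz : riemannZeta (b + y * I) ≠ 0 := riemannZeta_ne_zero_of_one_lt_re (by simp; linarith)
    refine (((differentiableAt_riemannZeta hne1).continuousAt.comp (x := y)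
      (f := fun y : ℝ ↦ (b : ℂ) + y * I) (by fun_prop)).inv₀ hz).mul ?_
    exact (continuousAt_const.div (by fun_prop) (hWs y))
  · rw [norm_mul, norm_div]
    have h1 := norm_inv_zeta_le_of_two_le_re (s := b + y * I) (by simp; linarith)
    have h2 : b - W.re ≤ ‖W - (b + y * I)‖ := by
      have := abs_re_le_norm (W - (b + y * I))
      simp only [sub_re, add_re, ofReal_re, mul_re, I_re, mul_zero, ofReal_im, I_im, mul_one,
        sub_self, add_zero] at this
      rw [abs_sub_comm] at this
      exact le_trans (le_abs_self _) this
    have hd : 0 < b - W.re := by linarith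
    have hB0 : 0 ≤ ∑' k : ℕ, (k : ℝ) ^ (-(2 : ℝ)) := tsum_nonneg fun n ↦ Real.rpow_nonneg (Nat.cast_nonneg n) _
    calc ‖(riemannZeta (b + y * I))⁻¹‖ * (‖κ‖ / ‖W - (b + y * I)‖)
        ≤ (∑' k : ℕ, (k : ℝ) ^ (-(2 : ℝ))) * (‖κ‖ / (b - W.re)) := by
          gcongr

/-- The function `(−c + (s−1)∫_1^∞ h t^{−s})/ζ₁(s)` (`ζ₁ = (s−1)ζ`, Mathlib's `riemannZeta₁`) is analytic
at `s = 1`. [folklore] -/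
private theorem analyticAt_numerator_div_zeta₁' (h h₁ : Lp ℂ 2 (volume : Measure ℝ))
    (hh₁ : ∀ᵐ x : ℝ, h₁ x = Set.indicator {x : ℝ | 1 < |x|} (h : ℝ → ℂ) x) (c : ℂ) :
    AnalyticAt ℂ (fun s ↦ (-c + (s - 1) * mellin (h₁ : ℝ → ℂ) (1 - s)) / riemannZeta₁ s) 1 := by
  have hO : IsOpen ({s : ℂ | 1 / 2 < s.re} ∩ {s | riemannZeta₁ s ≠ 0}) :=
    (isOpen_lt continuous_const Complex.continuous_re).inter
      (isOpen_ne_fun differentiable_riemannZeta₁.continuous continuous_const)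
  have h1 : (1 : ℂ) ∈ {s : ℂ | 1 / 2 < s.re} ∩ {s | riemannZeta₁ s ≠ 0} :=
    ⟨by norm_num, by simp [riemannZeta₁_one]⟩
  have hM := differentiableOn_mellin_trunc_one_sub h h₁ hh₁
  have hd : DifferentiableOn ℂ (fun s ↦ (-c + (s - 1) * mellin (h₁ : ℝ → ℂ) (1 - s)) / riemannZeta₁ s)
      ({s : ℂ | 1 / 2 < s.re} ∩ {s | riemannZeta₁ s ≠ 0}) := by
    intro z hz
    refine DifferentiableWithinAt.div ?_
      (differentiable_riemannZeta₁ z).differentiableWithinAt hz.2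
    exact ((differentiableAt_const _).add (((differentiableAt_id).sub (differentiableAt_const _)).mul
      ((hM z hz.1).differentiableAt ((isOpen_lt continuous_const Complex.continuous_re).mem_nhds hz.1))))
      |>.differentiableWithinAt
  exact hd.analyticAt (hO.mem_nhds h1)

set_option maxHeartbeats 1600000 in
/-- **Burnol 2004b, Thm. 5.2 — the POINTWISE residue expansion**: for every height sequence of
Prop. 5.1, every `g ∈ 𝓛₁` and every `Z ≠ 1` with `ζ(Z) ≠ 0`, "the series of residues
`Σ_ρ (G(ρ)/ζ′(ρ))·ζ(Z)/(Z−ρ)` converges absolutely pointwise to `G(Z)`" in the sense of Note 5: the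
blocks `T_n ≤ |Im ρ| < T_{n+1}` are summable and the partial sums tend to `G(Z)`.
(The first conjunct of the named fact `Burnol2004b_thm5_2`.)
[cite: Burnol2004b, Thm. 5.2 (arXiv:math/0203120v7 p. 12, TeX l.986–1050)] -/
theorem tendsto_burnolResiduePartialSum {A : ℝ} {T : ℕ → ℝ} (hT : IsInvZetaHeightSeq A T)
    {g : Lp ℂ 2 (volume : Measure ℝ)} (hg : g ∈ burnolScriptL1) {Z : ℂ} (hZ1 : Z ≠ 1)
    (hZ0 : riemannZeta Z ≠ 0) :
    Summable (fun n : ℕ ↦ ‖burnolResiduePartialSum (rightMellinExt g) T (n + 1) Z -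
        burnolResiduePartialSum (rightMellinExt g) T n Z‖) ∧
      Tendsto (fun n : ℕ ↦ burnolResiduePartialSum (rightMellinExt g) T n Z) atTop
        (𝓝 (rightMellinExt g Z)) := by
  classical
  -- ### data
  obtain ⟨-, ⟨c, hc⟩, -⟩ := hg.1
  have hgm : MemLp (Set.indicator {x : ℝ | 1 < |x|} (g : ℝ → ℂ)) 2 volume :=
    (Lp.memLp g).indicator (isOpen_lt continuous_const continuous_abs).measurableSet
  set g₁ : Lp ℂ 2 (volume : Measure ℝ) := hgm.toLp _ with hg₁def
  have hg₁ : ∀ᵐ x : ℝ, g₁ x = Set.indicator {x : ℝ | 1 < |x|} (g : ℝ → ℂ) x := hgm.coeFn_toLp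
  set G : ℂ → ℂ := rightMellinExt g with hGdef
  set hF : Lp ℂ 2 (volume : Measure ℝ) := 𝓕 g with hhFdef
  have hhF : hF ∈ burnolScriptL1 := Burnol2004b_lemma4_10_holds g hg
  obtain ⟨-, ⟨c', hc'⟩, -⟩ := hhF.1
  have hhm : MemLp (Set.indicator {x : ℝ | 1 < |x|} (hF : ℝ → ℂ)) 2 volume :=
    (Lp.memLp hF).indicator (isOpen_lt continuous_const continuous_abs).measurableSet
  set h₁ : Lp ℂ 2 (volume : Measure ℝ) := hhm.toLp _ with hh₁def
  have hh₁ : ∀ᵐ x : ℝ, h₁ x = Set.indicator {x : ℝ | 1 < |x|} (hF : ℝ → ℂ) x := hhm.coeFn_toLp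
  set H : ℂ → ℂ := rightMellinExt hF with hHdef
  set F : ℂ → ℂ := fun s ↦ G s / riemannZeta s * (riemannZeta Z / (Z - s)) with hFdef
  set S : ℕ → ℂ := fun n ↦ burnolResiduePartialSum G T n Z with hSdef
  -- ### height sequence
  have hTpos : ∀ n, 0 < T n := fun n ↦ lt_of_le_of_lt (Nat.cast_nonneg n) (hT.2.1 n)
  have hTmono : Monotone T := hT.1.monotone
  have hTtop : Tendsto T atTop atTop :=
    tendsto_atTop_mono (fun n ↦ (hT.2.1 n).le) tendsto_natCast_atTop_atTop
  set n₀ : ℕ := ⌈|Z.im|⌉₊ + 1 with hn₀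
  have hTn : ∀ n, n₀ ≤ n → |Z.im| + 1 ≤ T n := by
    intro n hn
    have h1 := hT.2.1 n
    have h2 : (n₀ : ℝ) ≤ n := by exact_mod_cast hn
    have h3 : |Z.im| ≤ ⌈|Z.im|⌉₊ := Nat.le_ceil _
    rw [hn₀] at h2; push_cast at h2
    linarith
  -- ### general differentiability of `F`
  have hGdiff : ∀ z : ℂ, z ≠ 1 → DifferentiableAt ℂ G z := fun z hz ↦
    differentiableAt_rightMellinExt hg.1 hz
  have hFdiff : ∀ z : ℂ, z ≠ 1 → riemannZeta z ≠ 0 → z ≠ Z → DifferentiableAt ℂ F z := by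
    intro z hz1 hζ hzZ
    exact ((hGdiff z hz1).div (differentiableAt_riemannZeta hz1) hζ).mul
      ((differentiableAt_const _).div ((differentiableAt_const _).sub differentiableAt_id)
        (sub_ne_zero.2 (Ne.symm hzZ)))
  -- ### the finite sets of zeros
  set Zn : ℕ → Finset ℂ := fun n ↦ (ntz_below_finite' (T n)).toFinset with hZndef
  have hZn : ∀ n ρ, ρ ∈ Zn n ↔ ρ ∈ ZetaZeros.riemannZetaNontrivialZeros ∧ |ρ.im| < T n := fun n ρ ↦ by
    simp [hZndef]
  have hSum : ∀ n, S n = ∑ ρ ∈ Zn n, Literature.Analysis.Complex.residueAt F ρ := fun n ↦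
    finsum_mem_eq_finite_toFinset_sum _ (ntz_below_finite' (T n))
  -- ### the removable point `s = 1`
  have hnear1 : F =ᶠ[𝓝[≠] 1] fun s ↦ (-c + (s - 1) * mellin (g₁ : ℝ → ℂ) (1 - s)) / riemannZeta₁ s *
      (riemannZeta Z / (Z - s)) := by
    filter_upwards [div_zeta_eventuallyEq_near_one g g₁ hg₁ hg.1 hc] with s hs
    have hs' : G s / riemannZeta s = (-c + (s - 1) * mellin (g₁ : ℝ → ℂ) (1 - s)) / riemannZeta₁ s := hs
    simp only [hFdef]
    rw [hs']
  have hΨ1 : AnalyticAt ℂ (fun s ↦ (-c + (s - 1) * mellin (g₁ : ℝ → ℂ) (1 - s)) / riemannZeta₁ s *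
      (riemannZeta Z / (Z - s))) 1 :=
    (analyticAt_numerator_div_zeta₁' g g₁ hg₁ c).mul
      (analyticAt_const.div (analyticAt_const.sub analyticAt_id) (sub_ne_zero.2 hZ1))
  obtain ⟨hV1, hmer1, hres1⟩ := removable_pack hΨ1 hnear1
  -- ### the simple pole `s = Z`, residue `−G(Z)`
  set u : ℂ → ℂ := fun s ↦ -(G s / riemannZeta s * riemannZeta Z) with hudef
  have hFu : F = fun s ↦ u s / (s - Z) := by
    funext s
    simp only [hFdef, hudef]
    rw [div_eq_mul_inv (riemannZeta Z), show (Z - s)⁻¹ = -(s - Z)⁻¹ by rw [← neg_sub s Z, inv_neg],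
      div_eq_mul_inv _ (s - Z)]
    ring
  have huan : AnalyticAt ℂ u Z := by
    have h1 : AnalyticAt ℂ G Z :=
      (hasRightMellinContinuation_rightMellinExt_of_mem_sonineL one_pos hg.1).1.analyticAt
        (isOpen_ne.mem_nhds hZ1)
    exact ((h1.div (analyticOn_riemannZeta Z hZ1) hZ0).mul analyticAt_const).neg
  have hresZ : Literature.Analysis.Complex.residueAt F Z = -G Z := by
    rw [hFu, residueAt_div_sub_self huan, hudef]
    simp only
    rw [div_mul_cancel₀ _ hZ0]
  have hmerZ : MeromorphicAt F Z := by
    rw [hFu]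
    exact huan.meromorphicAt.div ((analyticAt_id.sub analyticAt_const).meromorphicAt)
  have hVZ : ∃ V : Set ℂ, IsOpen V ∧ Z ∈ V ∧ ∀ z ∈ V, z ≠ Z → DifferentiableAt ℂ F z := by
    have hev : ∀ᶠ z in 𝓝 Z, riemannZeta z ≠ 0 ∧ z ≠ 1 :=
      ((differentiableAt_riemannZeta hZ1).continuousAt.eventually_ne hZ0).and (isOpen_ne.mem_nhds hZ1)
    obtain ⟨V, hVsub, hVo, hZV⟩ := mem_nhds_iff.1 hev
    exact ⟨V, hVo, hZV, fun z hz hzZ ↦ hFdiff z (hVsub hz).2 (hVsub hz).1 hzZ⟩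
  -- ### the non-trivial zeros
  have hVρ : ∀ p ∈ ZetaZeros.riemannZetaNontrivialZeros,
      ∃ V : Set ℂ, IsOpen V ∧ p ∈ V ∧ ∀ z ∈ V, z ≠ p → DifferentiableAt ℂ F z := by
    intro p hp
    have hρ := mem_riemannZetaNontrivialZeros_iff_holds.1 hp
    have hρ1 : p ≠ 1 := fun h1 ↦ by rw [h1] at hρ; norm_num at hρ
    have hρZ : p ≠ Z := fun h ↦ hZ0 (h ▸ hρ.1)
    have hev1 : ∀ᶠ z in 𝓝[≠] p, riemannZeta z ≠ 0 := by
      have h := (isDiscrete_iff_nhdsNE.1 isDiscrete_riemannZetaZeros) p hρ.1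
      rw [Filter.inf_principal_eq_bot] at h
      filter_upwards [h] with z hz
      simpa [mem_riemannZetaZeros] using hz
    have hev : ∀ᶠ z in 𝓝 p, (z ≠ p → riemannZeta z ≠ 0) ∧ z ≠ 1 ∧ z ≠ Z :=
      (eventually_nhdsWithin_iff.1 hev1).and ((isOpen_ne.eventually_mem hρ1).and
        (isOpen_ne.eventually_mem hρZ))
    obtain ⟨V, hVsub, hVo, hpV⟩ := mem_nhds_iff.1 hev
    exact ⟨V, hVo, hpV, fun z hz hzp ↦ hFdiff z (hVsub hz).2.1 ((hVsub hz).1 hzp) (hVsub hz).2.2⟩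
  have hmerρ : ∀ p ∈ ZetaZeros.riemannZetaNontrivialZeros, MeromorphicAt F p := by
    intro p hp
    have h := mem_riemannZetaNontrivialZeros_iff_holds.1 hp
    have hp1 : p ≠ 1 := by intro h1; rw [h1] at h; norm_num at h
    have hGa : AnalyticAt ℂ G p :=
      (hasRightMellinContinuation_rightMellinExt_of_mem_sonineL one_pos hg.1).1.analyticAt
        (isOpen_ne.mem_nhds hp1)
    exact (hGa.meromorphicAt.div (analyticOn_riemannZeta p hp1).meromorphicAt).mul
      (analyticAt_const.meromorphicAt.div (analyticAt_const.sub analyticAt_id).meromorphicAt)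
  -- ### the trivial zeros `−2(k+1)` as removable points
  have htriv : ∀ k : ℕ,
      (∃ V : Set ℂ, IsOpen V ∧ (-2 * ((k : ℂ) + 1)) ∈ V ∧
        ∀ z ∈ V, z ≠ -2 * ((k : ℂ) + 1) → DifferentiableAt ℂ F z) ∧
      MeromorphicAt F (-2 * ((k : ℂ) + 1)) ∧
      Literature.Analysis.Complex.residueAt F (-2 * ((k : ℂ) + 1)) = 0 := by
    intro k
    set t₀ : ℂ := -2 * ((k : ℂ) + 1) with ht₀
    set Ψ : ℂ → ℂ := fun s ↦ H (1 - s) / riemannZeta (1 - s) * (riemannZeta Z / (Z - s)) with hΨdef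
    have ht₀re : t₀.re = -2 * (k + 1) := by simp [ht₀]
    have hζt₀ : riemannZeta t₀ = 0 := by
      rw [ht₀]; exact_mod_cast riemannZeta_neg_two_mul_nat_add_one k
    have hZt₀ : Z ≠ t₀ := fun h ↦ hZ0 (h ▸ hζt₀)
    -- `Ψ` is differentiable near `t₀`
    have hΨd : ∀ s : ℂ, s.re < 0 → s ≠ Z → DifferentiableAt ℂ Ψ s := by
      intro s hs hsZ
      have h1s : (1 : ℂ) - s ≠ 1 := fun h ↦ by
        have := congrArg Complex.re h; simp at this; linarith
      have hζ1s : riemannZeta (1 - s) ≠ 0 := riemannZeta_ne_zero_of_one_lt_re (by simp; linarith)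
      have hH1 : DifferentiableAt ℂ (fun s ↦ H (1 - s)) s :=
        (differentiableAt_rightMellinExt hhF.1 h1s).comp s ((differentiableAt_const _).sub
          differentiableAt_id)
      have hζ1 : DifferentiableAt ℂ (fun s ↦ riemannZeta (1 - s)) s :=
        (differentiableAt_riemannZeta h1s).comp s ((differentiableAt_const _).sub differentiableAt_id)
      exact (hH1.div hζ1 hζ1s).mul ((differentiableAt_const _).div
        ((differentiableAt_const _).sub differentiableAt_id) (sub_ne_zero.2 (Ne.symm (Ne.symm hsZ) |>.symm)))
    have hevre : ∀ᶠ s in 𝓝 t₀, s.re < 0 ∧ s ≠ Z := by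
      refine (Complex.continuous_re.continuousAt.eventually_lt continuousAt_const ?_).and
        (isOpen_ne.mem_nhds (Ne.symm hZt₀))
      rw [ht₀re]; have : (0:ℝ) ≤ k := k.cast_nonneg; linarith
    have hΨan : AnalyticAt ℂ Ψ t₀ :=
      Complex.analyticAt_iff_eventually_differentiableAt.2 (hevre.mono fun s hs ↦ hΨd s hs.1 hs.2)
    -- `F = Ψ` on a punctured neighbourhood of `t₀`
    have hev1 : ∀ᶠ z in 𝓝[≠] t₀, riemannZeta z ≠ 0 := by
      have h := (isDiscrete_iff_nhdsNE.1 isDiscrete_riemannZetaZeros) t₀ (by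
        simpa [mem_riemannZetaZeros] using hζt₀)
      rw [Filter.inf_principal_eq_bot] at h
      filter_upwards [h] with z hz
      simpa [mem_riemannZetaZeros] using hz
    have hnear : F =ᶠ[𝓝[≠] t₀] Ψ := by
      filter_upwards [hev1, hevre.filter_mono nhdsWithin_le_nhds] with s hζs hs
      have h0 : ∀ n : ℕ, s ≠ -2 * (n : ℂ) := by
        intro n hsn
        rcases Nat.eq_zero_or_pos n with rfl | hn
        · have := hs.1; rw [hsn] at this; simp at this
        · obtain ⟨m, rfl⟩ := Nat.exists_eq_add_of_le hn
          apply hζs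
          rw [hsn]
          have := riemannZeta_neg_two_mul_nat_add_one m
          rw [show (-2 : ℂ) * ((1 + m : ℕ) : ℂ) = -2 * ((m : ℂ) + 1) by push_cast; ring]
          exact this
      have h1 : ∀ n : ℕ, s ≠ 1 + 2 * (n : ℂ) := by
        intro n hsn
        have := hs.1; rw [hsn] at this; simp at this
        have : (0 : ℝ) ≤ n := n.cast_nonneg
        linarith
      simp only [hFdef, hΨdef]
      rw [div_zeta_eq_fourier_one_sub hg.1 h0 h1]
    exact removable_pack hΨan hnear
  -- ### the sides `a = 1 − b`, `b = 2K + 5/2`, and the per-`K` analysis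
  set K₀ : ℕ := ⌈|Z.re|⌉₊ + 1 with hK₀
  set bK : ℕ → ℝ := fun K ↦ 2 * K + 5 / 2 with hbK
  have hbK2 : ∀ K, 2 ≤ bK K := fun K ↦ by
    simp only [hbK]; have : (0 : ℝ) ≤ K := K.cast_nonneg; linarith
  have hZin : ∀ K, K₀ ≤ K → 1 - bK K < Z.re ∧ Z.re < bK K := by
    intro K hK
    have h1 : |Z.re| ≤ ⌈|Z.re|⌉₊ := Nat.le_ceil _
    have h2 : (K₀ : ℝ) ≤ K := by exact_mod_cast hK
    rw [hK₀] at h2; push_cast at h2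
    have h3 := abs_le.1 (le_trans h1 (by linarith : (⌈|Z.re|⌉₊ : ℝ) ≤ K - 1))
    simp only [hbK]
    constructor <;> linarith [h3.1, h3.2]
  -- the constants of the vertical estimate
  set Bs : ℝ := ∑' k : ℕ, (k : ℝ) ^ (-(2 : ℝ)) with hBs
  set MG : ℝ := 2 * π * ‖c‖ ^ 2 + 4 * π * ‖g₁‖ ^ 2 with hMG
  set MH : ℝ := 2 * π * ‖c'‖ ^ 2 + 4 * π * ‖h₁‖ ^ 2 with hMH
  set ε : ℕ → ℝ := fun K ↦ (2 * π)⁻¹ * (‖riemannZeta Z‖ * Bs * (MG ^ (1 / 2 : ℝ) *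
      (π / (bK K - Z.re)) ^ (1 / 2 : ℝ)) + ‖-riemannZeta Z‖ * Bs * (MH ^ (1 / 2 : ℝ) *
      (π / (bK K - (1 - Z).re)) ^ (1 / 2 : ℝ))) with hεdef
  -- ### MAIN per-`K` statement
  have main : ∀ K, K₀ ≤ K → ∃ E : ℂ, ‖E‖ ≤ ε K ∧
      Summable (fun n : ℕ ↦ ‖S (n + 1) - S n‖) ∧ Tendsto S atTop (𝓝 (G Z + E)) := by
    intro K hK
    set b : ℝ := bK K with hbdef
    set a : ℝ := 1 - b with hadef
    have hb2 : 2 ≤ b := hbK2 K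
    have hab : a < b := by rw [hadef]; linarith
    have hZa : a < Z.re := (hZin K hK).1
    have hZb : Z.re < b := (hZin K hK).2
    have hZa' : (1 - Z).re < b := by simp only [sub_re, one_re]; linarith [hZa, hadef]
    -- the pole set
    set TZ : Finset ℂ := (Finset.range K).image (fun k : ℕ ↦ (-2 * ((k : ℂ) + 1))) with hTZ
    have hTZmem : ∀ p, p ∈ TZ ↔ ∃ k, k < K ∧ p = -2 * ((k : ℂ) + 1) := by
      intro p; simp only [hTZ, Finset.mem_image, Finset.mem_range]
      constructor
      · rintro ⟨k, hk, rfl⟩; exact ⟨k, hk, rfl⟩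
      · rintro ⟨k, hk, rfl⟩; exact ⟨k, hk, rfl⟩
    -- rectangle identity for `n ≥ n₀`
    have hrect : ∀ n, n₀ ≤ n → rectBoundaryIntegral F a b (-T n) (T n) =
        2 * Real.pi * I * (S n - G Z) := by
      intro n hn
      have hTn' := hTn n hn
      have hZim : |Z.im| < T n := by linarith
      set S' : Finset ℂ := insert Z (insert 1 (Zn n ∪ TZ)) with hS'
      -- classification of the poles
      have hcl : ∀ p ∈ S', p = Z ∨ p = 1 ∨ p ∈ ZetaZeros.riemannZetaNontrivialZeros ∧ |p.im| < T n ∨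
          ∃ k, k < K ∧ p = -2 * ((k : ℂ) + 1) := by
        intro p hp
        rw [hS', Finset.mem_insert, Finset.mem_insert, Finset.mem_union] at hp
        rcases hp with h | h | h | h
        · exact Or.inl h
        · exact Or.inr (Or.inl h)
        · exact Or.inr (Or.inr (Or.inl ((hZn n p).1 h)))
        · exact Or.inr (Or.inr (Or.inr ((hTZmem p).1 h)))
      have hV : ∀ p ∈ S', ∃ V : Set ℂ, IsOpen V ∧ p ∈ V ∧ ∀ z ∈ V, z ≠ p → DifferentiableAt ℂ F z := by
        intro p hp
        rcases hcl p hp with rfl | rfl | ⟨h, -⟩ | ⟨k, -, rfl⟩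
        · exact hVZ
        · exact hV1
        · exact hVρ p h
        · exact (htriv k).1
      choose! V hVo hpV hVd using hV
      set U : Set ℂ := {z | AnalyticAt ℂ F z} ∪ ⋃ p ∈ S', V p with hU
      have hUo : IsOpen U := (isOpen_analyticAt ℂ F).union (isOpen_biUnion fun p hp ↦ hVo p hp)
      -- distinctness
      have hZ_notin : Z ∉ insert 1 (Zn n ∪ TZ) := by
        rw [Finset.mem_insert, Finset.mem_union]
        rintro (h | h | h)
        · exact hZ1 h
        · exact hZ0 (mem_riemannZetaNontrivialZeros_iff_holds.1 ((hZn n Z).1 h).1).1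
        · obtain ⟨k, -, hk⟩ := (hTZmem Z).1 h
          exact hZ0 (by rw [hk]; exact_mod_cast riemannZeta_neg_two_mul_nat_add_one k)
      have h1_notin : (1 : ℂ) ∉ Zn n ∪ TZ := by
        rw [Finset.mem_union]
        rintro (h | h)
        · exact riemannZeta_one_ne_zero (mem_riemannZetaNontrivialZeros_iff_holds.1 ((hZn n 1).1 h).1).1
        · obtain ⟨k, -, hk⟩ := (hTZmem 1).1 h
          have := congrArg Complex.re hk; simp at this; linarith
      have hdisj : Disjoint (Zn n) TZ := by
        rw [Finset.disjoint_left]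
        intro p hp hpT
        have h := mem_riemannZetaNontrivialZeros_iff_holds.1 ((hZn n p).1 hp).1
        obtain ⟨k, -, hk⟩ := (hTZmem p).1 hpT
        rw [hk] at h; simp at h
        have : (0 : ℝ) ≤ k := k.cast_nonneg; linarith [h.2.1]
      have hsumT : ∑ p ∈ TZ, Literature.Analysis.Complex.residueAt F p = 0 := by
        refine Finset.sum_eq_zero fun p hp ↦ ?_
        obtain ⟨k, -, rfl⟩ := (hTZmem p).1 hp
        exact (htriv k).2.2
      have key := rectBoundaryIntegral_eq_sum_residueAt hab (by linarith [hTpos n] : -T n < T n) S' F U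
        hUo ?_ ?_ ?_ ?_
      · rw [key, hS', Finset.sum_insert hZ_notin, Finset.sum_insert h1_notin, Finset.sum_union hdisj,
          hresZ, hres1, hsumT, ← hSum n]
        ring
      · -- the closed rectangle lies in `U`
        intro z hz
        rw [mem_reProdIm] at hz
        by_cases hzS : z ∈ S'
        · exact Or.inr (mem_iUnion₂.2 ⟨z, hzS, hpV z hzS⟩)
        · left
          have hz1 : z ≠ 1 := fun h1 ↦ hzS (by rw [hS', h1]; simp)
          have hzZ : z ≠ Z := fun h1 ↦ hzS (by rw [hS', h1]; simp)
          have hζ : riemannZeta z ≠ 0 := by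
            intro h0
            rcases zero_dichotomy h0 with hntz | ⟨m, hm⟩
            · have h' := mem_riemannZetaNontrivialZeros_iff_holds.1 hntz
              have hne : |z.im| ≠ T n := fun habs ↦
                zeta_ne_zero_of_isInvZetaHeightSeq hT n habs (by linarith [h'.2.1]) h0
              have hlt : |z.im| < T n := lt_of_le_of_ne (abs_le.2 hz.2) hne
              exact hzS (by
                rw [hS']
                exact Finset.mem_insert_of_mem (Finset.mem_insert_of_mem
                  (Finset.mem_union_left _ ((hZn n z).2 ⟨hntz, hlt⟩))))
            · have hre := hz.1.1
              rw [hm] at hre; simp [hadef, hbdef, hbK] at hre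
              have hmK : m < K := by
                by_contra hmK; push Not at hmK
                have : (K : ℝ) ≤ m := by exact_mod_cast hmK
                linarith
              exact hzS (by
                rw [hS']
                exact Finset.mem_insert_of_mem (Finset.mem_insert_of_mem
                  (Finset.mem_union_right _ ((hTZmem z).2 ⟨m, hmK, hm⟩))))
          have hev : ∀ᶠ w in 𝓝 z, DifferentiableAt ℂ F w := by
            filter_upwards [(differentiableAt_riemannZeta hz1).continuousAt.eventually_ne hζ,
              isOpen_ne.mem_nhds hz1, isOpen_ne.mem_nhds hzZ] with w hw hw1 hwZ
            exact hFdiff w hw1 hw hwZ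
          exact Complex.analyticAt_iff_eventually_differentiableAt.2 hev
      · -- the poles lie in the open rectangle
        intro p hp
        rw [mem_reProdIm]
        rcases hcl p (Finset.mem_coe.1 hp) with rfl | rfl | ⟨hntz, hlt⟩ | ⟨k, hk, rfl⟩
        · exact ⟨⟨hZa, hZb⟩, abs_lt.1 hZim⟩
        · refine ⟨⟨by simp; rw [hadef]; linarith, by simp; linarith⟩, ⟨by simp; exact hTpos n, by simp; exact hTpos n⟩⟩
        · have h := mem_riemannZetaNontrivialZeros_iff_holds.1 hntz
          exact ⟨⟨by rw [hadef]; linarith [h.2.1], by linarith [h.2.2]⟩, abs_lt.1 hlt⟩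
        · have hk' : (k : ℝ) + 1 ≤ K := by exact_mod_cast hk
          refine ⟨⟨?_, ?_⟩, ⟨by simp; exact hTpos n, by simp; exact hTpos n⟩⟩
          · simp [hadef, hbdef, hbK]; linarith
          · simp [hbdef, hbK]; have : (0:ℝ) ≤ k := k.cast_nonneg; linarith
      · -- differentiability on `U ∖ S'`
        intro z hz
        have hzS : z ∉ S' := fun h' ↦ hz.2 (Finset.mem_coe.2 h')
        rcases hz.1 with h' | h'
        · exact h'.differentiableAt.differentiableWithinAt
        · obtain ⟨p, hp, hzp⟩ := mem_iUnion₂.1 h'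
          exact (hVd p hp z hzp (fun h'' ↦ hzS (h'' ▸ hp))).differentiableWithinAt
      · -- meromorphy at the poles
        intro p hp
        rcases hcl p hp with rfl | rfl | ⟨h, -⟩ | ⟨k, -, rfl⟩
        · exact hmerZ
        · exact hmer1
        · exact hmerρ p h
        · exact (htriv k).2.1
    -- ### the four sides and their limits
    set bot : ℕ → ℂ := fun n ↦ ∫ x in a..b, F (x + ((-T n : ℝ) : ℂ) * I) with hbot
    set top : ℕ → ℂ := fun n ↦ ∫ x in a..b, F (x + ((T n : ℝ) : ℂ) * I) with htop
    set rgt : ℕ → ℂ := fun n ↦ ∫ y in (-T n)..T n, F (b + y * I) with hrgt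
    set lft : ℕ → ℂ := fun n ↦ ∫ y in (-T n)..T n, F (a + y * I) with hlft
    have hRBI : ∀ n, rectBoundaryIntegral F a b (-T n) (T n) = bot n - top n + I * rgt n - I * lft n := by
      intro n; simp only [rectBoundaryIntegral_def, hbot, htop, hrgt, hlft]
    have h2πI : (2 * Real.pi * I : ℂ) ≠ 0 := by simp [Real.pi_pos.ne', I_ne_zero]
    have hSeq : ∀ n, n₀ ≤ n → S n = G Z + (2 * Real.pi * I)⁻¹ * (bot n - top n + I * rgt n - I * lft n) := by
      intro n hn
      rw [← hRBI n, hrect n hn, ← mul_assoc, inv_mul_cancel₀ h2πI, one_mul]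
      ring
    -- horizontal decay: the three ranges
    obtain ⟨CN, hCN⟩ := hg.2 (-1) 2 (⌈A⌉₊ + 2)
    obtain ⟨C2, hC2⟩ := hg.2 2 b 2
    obtain ⟨CH, hCH⟩ := hhF.2 2 b 2
    have hAN : A - (⌈A⌉₊ + 2 : ℕ) ≤ -2 := by
      have := Nat.le_ceil A; push_cast; linarith
    have hBs0 : 0 ≤ Bs := tsum_nonneg fun n ↦ Real.rpow_nonneg (Nat.cast_nonneg n) _
    set D : ℝ := max CN 0 + Bs * (max C2 0 + max CH 0) with hD
    have hD0 : 0 ≤ D := by positivity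
    -- `‖G(s)/ζ(s)‖ ≤ D / T_n²` on the horizontal sides
    have hquot : ∀ n, 1 ≤ n → ∀ x ∈ Icc a b, ∀ y : ℝ, |y| = T n →
        ‖G (x + y * I) / riemannZeta (x + y * I)‖ ≤ D / T n ^ 2 := by
      intro n hn x hx y hy
      have hTn1 : 1 ≤ T n := by
        have h1 := hT.2.1 n
        have h2 : (1 : ℝ) ≤ n := by exact_mod_cast hn
        linarith
      set s : ℂ := x + y * I with hs
      have hsre : s.re = x := by simp [hs]
      have hsim : s.im = y := by simp [hs]
      have hTle : T n ≤ ‖s‖ := by rw [← hy, ← hsim]; exact abs_im_le_norm s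
      have hs1 : 1 ≤ ‖s‖ := hTn1.trans hTle
      have hs0 : 0 < ‖s‖ := by linarith
      have hpow2 : ‖s‖ ^ (-((2 : ℕ) : ℝ)) ≤ (T n ^ 2)⁻¹ := by
        rw [Real.rpow_neg hs0.le, Real.rpow_natCast]
        exact inv_anti₀ (by positivity) (pow_le_pow_left₀ (hTpos n).le hTle 2)
      -- each of the three bounds is `≤ D / T n ^ 2`
      have hT2 : 0 < T n ^ 2 := by positivity
      have hmid : x ∈ Icc (-1 : ℝ) 2 → ‖G s / riemannZeta s‖ ≤ max CN 0 / T n ^ 2 := by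
        intro hx'
        have hζ := hT.2.2 n s (by rw [hsim]; exact hy) (by rw [hsre]; exact hx'.1) (by rw [hsre]; exact hx'.2)
        have hGs := hCN s (by rw [hsre]; exact hx'.1) (by rw [hsre]; exact hx'.2)
          (by rw [hsim, hy]; exact hTn1)
        calc ‖G s / riemannZeta s‖ = ‖G s‖ * ‖riemannZeta s‖⁻¹ := by rw [norm_div, div_eq_mul_inv]
          _ ≤ (max CN 0 * ‖s‖ ^ (-((⌈A⌉₊ + 2 : ℕ) : ℝ))) * ‖s‖ ^ A :=
              mul_le_mul (hGs.trans (by gcongr; exact le_max_left _ _)) hζ.le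
                (inv_nonneg.2 (norm_nonneg _)) (by positivity)
          _ = max CN 0 * ‖s‖ ^ (A - (⌈A⌉₊ + 2 : ℕ)) := by
              rw [mul_assoc, ← Real.rpow_add hs0]; ring_nf
          _ ≤ max CN 0 * ‖s‖ ^ (-((2 : ℕ) : ℝ)) :=
              mul_le_mul_of_nonneg_left (Real.rpow_le_rpow_of_exponent_le hs1 (by
                simpa using hAN)) (le_max_right _ _)
          _ ≤ max CN 0 * (T n ^ 2)⁻¹ := mul_le_mul_of_nonneg_left hpow2 (le_max_right _ _)
          _ = max CN 0 / T n ^ 2 := by rw [div_eq_mul_inv]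
      have hright : x ∈ Icc (2 : ℝ) b → ‖G s / riemannZeta s‖ ≤ Bs * max C2 0 / T n ^ 2 := by
        intro hx'
        have hζ := norm_inv_zeta_le_of_two_le_re (s := s) (by rw [hsre]; exact hx'.1)
        have hGs := hC2 s (by rw [hsre]; exact hx'.1) (by rw [hsre]; exact hx'.2)
          (by rw [hsim, hy]; exact hTn1)
        calc ‖G s / riemannZeta s‖ = ‖G s‖ * ‖(riemannZeta s)⁻¹‖ := by
              rw [norm_div, div_eq_mul_inv, norm_inv]
          _ ≤ (max C2 0 * ‖s‖ ^ (-((2 : ℕ) : ℝ))) * Bs :=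
              mul_le_mul (hGs.trans (by gcongr; exact le_max_left _ _)) hζ (norm_nonneg _) (by positivity)
          _ ≤ (max C2 0 * (T n ^ 2)⁻¹) * Bs := by gcongr
          _ = Bs * max C2 0 / T n ^ 2 := by ring
      have hleft : x ∈ Icc a (-1 : ℝ) → ‖G s / riemannZeta s‖ ≤ Bs * max CH 0 / T n ^ 2 := by
        intro hx'
        have hyne : s.im ≠ 0 := by rw [hsim]; intro h0; rw [h0, abs_zero] at hy; linarith
        rw [show G s / riemannZeta s = H (1 - s) / riemannZeta (1 - s) from
          div_zeta_eq_fourier_one_sub_of_im_ne_zero hg.1 hyne]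
        have h1re : (1 - s).re = 1 - x := by simp [hsre]
        have h1im : |(1 - s).im| = T n := by simp [hsim, hy]
        have hζ := norm_inv_zeta_le_of_two_le_re (s := 1 - s) (by rw [h1re]; linarith [hx'.2])
        have hHs := hCH (1 - s) (by rw [h1re]; linarith [hx'.2]) (by rw [h1re, hadef] at *; linarith [hx'.1])
          (by rw [h1im]; exact hTn1)
        have h1T : T n ≤ ‖1 - s‖ := by rw [← h1im]; exact abs_im_le_norm _
        have h1pos : 0 < ‖1 - s‖ := by linarith
        have hpow2' : ‖1 - s‖ ^ (-((2 : ℕ) : ℝ)) ≤ (T n ^ 2)⁻¹ := by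
          rw [Real.rpow_neg h1pos.le, Real.rpow_natCast]
          exact inv_anti₀ (by positivity) (pow_le_pow_left₀ (hTpos n).le h1T 2)
        calc ‖H (1 - s) / riemannZeta (1 - s)‖ = ‖H (1 - s)‖ * ‖(riemannZeta (1 - s))⁻¹‖ := by
              rw [norm_div, div_eq_mul_inv, norm_inv]
          _ ≤ (max CH 0 * ‖1 - s‖ ^ (-((2 : ℕ) : ℝ))) * Bs :=
              mul_le_mul (hHs.trans (by gcongr; exact le_max_left _ _)) hζ (norm_nonneg _) (by positivity)
          _ ≤ (max CH 0 * (T n ^ 2)⁻¹) * Bs := by gcongr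
          _ = Bs * max CH 0 / T n ^ 2 := by ring
      -- combine
      have hx3 : x ∈ Icc (-1 : ℝ) 2 ∨ x ∈ Icc (2 : ℝ) b ∨ x ∈ Icc a (-1 : ℝ) := by
        rcases le_or_gt x (-1) with h | h
        · exact Or.inr (Or.inr ⟨hx.1, h⟩)
        rcases le_or_gt x 2 with h' | h'
        · exact Or.inl ⟨h.le, h'⟩
        · exact Or.inr (Or.inl ⟨h'.le, hx.2⟩)
      have p1 : 0 ≤ Bs * max C2 0 := mul_nonneg hBs0 (le_max_right _ _)
      have p2 : 0 ≤ Bs * max CH 0 := mul_nonneg hBs0 (le_max_right _ _)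
      have p3 : 0 ≤ max CN 0 := le_max_right _ _
      have hDexp : D = max CN 0 + Bs * max C2 0 + Bs * max CH 0 := by rw [hD]; ring
      have e1 : max CN 0 / T n ^ 2 ≤ D / T n ^ 2 :=
        div_le_div_of_nonneg_right (by rw [hDexp]; linarith) hT2.le
      have e2 : Bs * max C2 0 / T n ^ 2 ≤ D / T n ^ 2 :=
        div_le_div_of_nonneg_right (by rw [hDexp]; linarith) hT2.le
      have e3 : Bs * max CH 0 / T n ^ 2 ≤ D / T n ^ 2 :=
        div_le_div_of_nonneg_right (by rw [hDexp]; linarith) hT2.le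
      rcases hx3 with h | h | h
      · exact (hmid h).trans e1
      · exact (hright h).trans e2
      · exact (hleft h).trans e3
    -- `‖F‖ ≤ ‖ζ Z‖ D / T_n²` on the horizontal sides, `n ≥ n₀`
    have hhor : ∀ n, n₀ ≤ n → ∀ x ∈ Icc a b, ∀ y : ℝ, |y| = T n →
        ‖F (x + y * I)‖ ≤ ‖riemannZeta Z‖ * D / T n ^ 2 := by
      intro n hn x hx y hy
      have hn1 : 1 ≤ n := le_trans (by rw [hn₀]; omega) hn
      have hq := hquot n hn1 x hx y hy
      have hTn' := hTn n hn
      have hker : ‖riemannZeta Z / (Z - (x + y * I))‖ ≤ ‖riemannZeta Z‖ := by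
        rw [norm_div]
        refine div_le_self (norm_nonneg _) ?_
        have h1 := abs_im_le_norm (Z - (x + y * I))
        simp only [sub_im, add_im, ofReal_im, mul_im, ofReal_re, I_im, mul_one, I_re, mul_zero,
          add_zero, zero_add] at h1
        have h2 : 1 ≤ |Z.im - y| := by
          have := abs_sub_abs_le_abs_sub y Z.im
          rw [abs_sub_comm] at this
          rw [hy] at this; linarith
        linarith
      calc ‖F (x + y * I)‖ = ‖G (x + y * I) / riemannZeta (x + y * I)‖ *
            ‖riemannZeta Z / (Z - (x + y * I))‖ := by rw [hFdef]; exact norm_mul _ _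
        _ ≤ (D / T n ^ 2) * ‖riemannZeta Z‖ :=
            mul_le_mul hq hker (norm_nonneg _) (by positivity)
        _ = ‖riemannZeta Z‖ * D / T n ^ 2 := by ring
    have hbot_le : ∀ n, n₀ ≤ n → ‖bot n‖ ≤ ‖riemannZeta Z‖ * D / T n ^ 2 * |b - a| := by
      intro n hn
      refine intervalIntegral.norm_integral_le_of_norm_le_const fun x hx ↦ ?_
      rw [uIoc_of_le hab.le] at hx
      exact hhor n hn x ⟨hx.1.le, hx.2⟩ (-T n) (by rw [abs_neg, abs_of_pos (hTpos n)])
    have htop_le : ∀ n, n₀ ≤ n → ‖top n‖ ≤ ‖riemannZeta Z‖ * D / T n ^ 2 * |b - a| := by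
      intro n hn
      refine intervalIntegral.norm_integral_le_of_norm_le_const fun x hx ↦ ?_
      rw [uIoc_of_le hab.le] at hx
      exact hhor n hn x ⟨hx.1.le, hx.2⟩ (T n) (abs_of_pos (hTpos n))
    -- vertical integrability: right side
    obtain ⟨hmc, hmb⟩ := multiplier_cont_bdd hb2 hZb (riemannZeta Z)
    have hGint : Integrable fun y : ℝ ↦ G (b + y * I) :=
      integrable_rightMellinExt_line hg (σ := b) (by linarith)
    have hFb : ∀ y : ℝ, F (b + y * I) =
        G (b + y * I) * ((riemannZeta (b + y * I))⁻¹ * (riemannZeta Z / (Z - (b + y * I)))) := by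
      intro y; simp only [hFdef]; rw [div_eq_mul_inv, mul_assoc]
    have hFintb : Integrable fun y : ℝ ↦ F (b + y * I) := by
      simp_rw [hFb]
      exact hGint.mul_bdd hmc.aestronglyMeasurable (Eventually.of_forall hmb)
    -- vertical integrability: left side through the functional equation
    obtain ⟨hmc', hmb'⟩ := multiplier_cont_bdd hb2 hZa' (-riemannZeta Z)
    have hHint : Integrable fun y : ℝ ↦ H (b + y * I) :=
      integrable_rightMellinExt_line hhF (σ := b) (by linarith)
    set Ψl : ℝ → ℂ := fun y ↦ H (b + y * I) / riemannZeta (b + y * I) *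
      (-riemannZeta Z / ((1 - Z) - (b + y * I))) with hΨl
    have hΨlint : Integrable Ψl := by
      have : Ψl = fun y : ℝ ↦ H (b + y * I) * ((riemannZeta (b + y * I))⁻¹ *
          (-riemannZeta Z / ((1 - Z) - (b + y * I)))) := by
        funext y; simp only [hΨl]; rw [div_eq_mul_inv, mul_assoc]
      rw [this]
      exact hHint.mul_bdd hmc'.aestronglyMeasurable (Eventually.of_forall hmb')
    have hside : ∀ y : ℝ, (∀ n : ℕ, (a : ℂ) + y * I ≠ -2 * (n : ℂ)) ∧
        ∀ n : ℕ, (a : ℂ) + y * I ≠ 1 + 2 * (n : ℂ) := by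
      intro y
      have hb' : b = 2 * K + 5 / 2 := by rw [hbdef]
      have e1 : ((a : ℂ) + y * I).re = a := by simp
      constructor
      · intro n h0
        have h1 := congrArg Complex.re h0
        have e2 : (-2 * (n : ℂ)).re = -2 * n := by simp
        rw [e1, e2] at h1
        have h4 : (4 * n : ℝ) = 4 * K + 3 := by linarith [hadef]
        norm_cast at h4; omega
      · intro n h0
        have h1 := congrArg Complex.re h0
        have e2 : (1 + 2 * (n : ℂ)).re = 1 + 2 * n := by simp
        rw [e1, e2] at h1
        have h4 : (4 * n + 4 * K + 5 : ℝ) = 0 := by linarith [hadef]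
        norm_cast at h4
    have hFa : ∀ y : ℝ, F (a + y * I) = Ψl (-y) := by
      intro y
      obtain ⟨h0, h1⟩ := hside y
      simp only [hFdef, hΨl]
      rw [div_zeta_eq_fourier_one_sub hg.1 h0 h1]
      have e1 : (1 : ℂ) - (a + y * I) = b + ((-y : ℝ) : ℂ) * I := by
        rw [hadef]; push_cast; ring
      have e2 : riemannZeta Z / (Z - (a + y * I)) = -riemannZeta Z / ((1 - Z) - (b + ((-y : ℝ) : ℂ) * I)) := by
        rw [← e1, show (1 : ℂ) - Z - (1 - (a + y * I)) = -(Z - (a + y * I)) by ring, div_neg, neg_div,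
          neg_neg]
      rw [e1, e2]
    have hFinta : Integrable fun y : ℝ ↦ F (a + y * I) := by
      simp_rw [hFa]; exact hΨlint.comp_neg
    have hVa : ∫ y : ℝ, F (a + y * I) = ∫ y : ℝ, Ψl y := by
      simp_rw [hFa]; exact integral_neg_eq_self Ψl volume
    -- limits
    have hδ : Tendsto (fun n ↦ ‖riemannZeta Z‖ * D / T n ^ 2 * |b - a|) atTop (𝓝 0) := by
      have h1 : Tendsto (fun n ↦ T n ^ 2) atTop atTop := (tendsto_pow_atTop two_ne_zero).comp hTtop
      simpa using (tendsto_const_nhds.div_atTop h1).mul_const |b - a|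
    have hbot0 : Tendsto bot atTop (𝓝 0) := squeeze_zero_norm' (eventually_atTop.2 ⟨n₀, hbot_le⟩) hδ
    have htop0 : Tendsto top atTop (𝓝 0) := squeeze_zero_norm' (eventually_atTop.2 ⟨n₀, htop_le⟩) hδ
    have hneg : Tendsto (fun n ↦ -T n) atTop atBot := tendsto_neg_atTop_atBot.comp hTtop
    have hrgt0 : Tendsto rgt atTop (𝓝 (∫ y : ℝ, F (b + y * I))) :=
      intervalIntegral_tendsto_integral hFintb hneg hTtop
    have hlft0 : Tendsto lft atTop (𝓝 (∫ y : ℝ, Ψl y)) := by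
      rw [← hVa]; exact intervalIntegral_tendsto_integral hFinta hneg hTtop
    set E : ℂ := (2 * Real.pi * I)⁻¹ * (I * (∫ y : ℝ, F (b + y * I)) - I * ∫ y : ℝ, Ψl y) with hE
    -- the bound on `E`
    have hVb_le := norm_integral_vertical_le hg.1 hc g₁ hg₁ hb2 hZb (riemannZeta Z)
    have hVa_le := norm_integral_vertical_le hhF.1 hc' h₁ hh₁ hb2 hZa' (-riemannZeta Z)
    have hnorm2πI : ‖(2 * Real.pi * I : ℂ)⁻¹‖ = (2 * π)⁻¹ := by
      simp [norm_inv, Complex.norm_I, abs_of_pos Real.pi_pos]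
    have hEle : ‖E‖ ≤ ε K := by
      rw [hE, norm_mul, hnorm2πI, hεdef]
      simp only
      gcongr
      calc ‖I * (∫ y : ℝ, F (b + y * I)) - I * ∫ y : ℝ, Ψl y‖
          ≤ ‖I * ∫ y : ℝ, F (b + y * I)‖ + ‖I * ∫ y : ℝ, Ψl y‖ := norm_sub_le _ _
        _ = ‖∫ y : ℝ, F (b + y * I)‖ + ‖∫ y : ℝ, Ψl y‖ := by simp [Complex.norm_I]
        _ ≤ _ := add_le_add (by simpa only [hFdef] using hVb_le) (by simpa only [hΨl] using hVa_le)
    refine ⟨E, hEle, ?_, ?_⟩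
    · -- ### summability of the blocks
      have hTsucc : ∀ n, T n ≤ T (n + 1) := fun n ↦ hTmono (Nat.le_succ n)
      set ap : ℕ → ℝ := fun n ↦ ∫ y in (-T n)..T n, ‖F (b + y * I)‖ with hap
      set am : ℕ → ℝ := fun n ↦ ∫ y in (-T n)..T n, ‖F (a + y * I)‖ with ham
      have hrgt_le : ∀ n, ‖rgt (n + 1) - rgt n‖ ≤ ap (n + 1) - ap n := fun n ↦
        norm_intervalIntegral_sub_le' hFintb (hTsucc n)
      have hlft_le : ∀ n, ‖lft (n + 1) - lft n‖ ≤ am (n + 1) - am n := fun n ↦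
        norm_intervalIntegral_sub_le' hFinta (hTsucc n)
      have hap_sum : Summable fun n ↦ ap (n + 1) - ap n := by
        refine summable_sub_of_monotone_bounded' (monotone_nat_of_le_succ fun n ↦ ?_)
          (B := ∫ y : ℝ, ‖F (b + y * I)‖) fun n ↦ ?_
        · linarith [hrgt_le n, norm_nonneg (rgt (n + 1) - rgt n)]
        · rw [hap]; simp only
          rw [intervalIntegral.integral_of_le (by linarith [hTpos n])]
          exact setIntegral_le_integral hFintb.norm (Eventually.of_forall fun y ↦ norm_nonneg _)
      have ham_sum : Summable fun n ↦ am (n + 1) - am n := by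
        refine summable_sub_of_monotone_bounded' (monotone_nat_of_le_succ fun n ↦ ?_)
          (B := ∫ y : ℝ, ‖F (a + y * I)‖) fun n ↦ ?_
        · linarith [hlft_le n, norm_nonneg (lft (n + 1) - lft n)]
        · rw [ham]; simp only
          rw [intervalIntegral.integral_of_le (by linarith [hTpos n])]
          exact setIntegral_le_integral hFinta.norm (Eventually.of_forall fun y ↦ norm_nonneg _)
      have hmaj : Summable fun n : ℕ ↦ ‖riemannZeta Z‖ * D * |b - a| / ((n : ℝ) + 1) ^ 2 := by
        have h1 : Summable fun n : ℕ ↦ 1 / ((n : ℝ) + 1) ^ 2 := by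
          have := (summable_nat_add_iff 1).2 (Real.summable_one_div_nat_pow.2 one_lt_two)
          refine this.congr fun n ↦ ?_
          push_cast; ring_nf
        refine (h1.mul_left (‖riemannZeta Z‖ * D * |b - a|)).congr fun n ↦ ?_
        ring
      have hhor_sum : ∀ side : ℕ → ℂ,
          (∀ n, n₀ ≤ n → ‖side n‖ ≤ ‖riemannZeta Z‖ * D / T n ^ 2 * |b - a|) →
          Summable fun n ↦ ‖side n‖ := by
        intro side hside'
        refine (summable_nat_add_iff n₀).1 (Summable.of_nonneg_of_le (fun n ↦ norm_nonneg _)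
          (fun n ↦ ?_) hmaj)
        have hn1 : (n : ℝ) + 1 ≤ T (n + n₀) := by
          have h1 := hT.2.1 (n + n₀)
          have h2 : (1 : ℝ) ≤ n₀ := by rw [hn₀]; push_cast; linarith [Nat.cast_nonneg (α := ℝ) ⌈|Z.im|⌉₊]
          push_cast at h1; linarith
        have hn0 : (0 : ℝ) < (n : ℝ) + 1 := by positivity
        calc ‖side (n + n₀)‖ ≤ ‖riemannZeta Z‖ * D / T (n + n₀) ^ 2 * |b - a| :=
              hside' (n + n₀) (by omega)
          _ = ‖riemannZeta Z‖ * D * |b - a| / T (n + n₀) ^ 2 := by ring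
          _ ≤ ‖riemannZeta Z‖ * D * |b - a| / ((n : ℝ) + 1) ^ 2 := by
              apply div_le_div_of_nonneg_left (by positivity) (by positivity)
              exact pow_le_pow_left₀ hn0.le hn1 2
      have hbot_sum := hhor_sum bot hbot_le
      have htop_sum := hhor_sum top htop_le
      have htri : ∀ b' t r l : ℂ, ‖b' - t + I * r - I * l‖ ≤ ‖b'‖ + ‖t‖ + ‖r‖ + ‖l‖ := by
        intro b' t r l
        calc ‖b' - t + I * r - I * l‖ ≤ ‖b' - t + I * r‖ + ‖I * l‖ := norm_sub_le _ _
          _ ≤ ‖b' - t‖ + ‖I * r‖ + ‖I * l‖ := by gcongr; exact norm_add_le _ _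
          _ ≤ ‖b'‖ + ‖t‖ + ‖I * r‖ + ‖I * l‖ := by gcongr; exact norm_sub_le _ _
          _ = ‖b'‖ + ‖t‖ + ‖r‖ + ‖l‖ := by simp [Complex.norm_I]
      set M : ℕ → ℝ := fun n ↦ (2 * π)⁻¹ * ((‖bot (n + 1)‖ + ‖bot n‖) + (‖top (n + 1)‖ + ‖top n‖) +
        (ap (n + 1) - ap n) + (am (n + 1) - am n)) with hM
      have hM_sum : Summable M :=
        (((((summable_nat_add_iff 1).2 hbot_sum).add hbot_sum).add
          (((summable_nat_add_iff 1).2 htop_sum).add htop_sum)).add hap_sum |>.add ham_sum).mul_left _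
      have hinc : ∀ n, n₀ ≤ n → ‖S (n + 1) - S n‖ ≤ M n := by
        intro n hn
        rw [hSeq (n + 1) (by omega), hSeq n hn, hM]
        simp only
        rw [show ∀ e x y : ℂ, G Z + e * x - (G Z + e * y) = e * (x - y) from fun e x y ↦ by ring,
          norm_mul, hnorm2πI]
        gcongr
        have e : bot (n + 1) - top (n + 1) + I * rgt (n + 1) - I * lft (n + 1) -
            (bot n - top n + I * rgt n - I * lft n) =
            (bot (n + 1) - bot n) - (top (n + 1) - top n) + I * (rgt (n + 1) - rgt n) -
              I * (lft (n + 1) - lft n) := by ring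
        rw [e]
        calc _ ≤ ‖bot (n + 1) - bot n‖ + ‖top (n + 1) - top n‖ + ‖rgt (n + 1) - rgt n‖ +
              ‖lft (n + 1) - lft n‖ := htri _ _ _ _
          _ ≤ (‖bot (n + 1)‖ + ‖bot n‖) + (‖top (n + 1)‖ + ‖top n‖) + (ap (n + 1) - ap n) +
              (am (n + 1) - am n) := by
              gcongr
              · exact norm_sub_le _ _
              · exact norm_sub_le _ _
              · exact hrgt_le n
              · exact hlft_le n
      refine (summable_nat_add_iff n₀).1 (Summable.of_nonneg_of_le (fun n ↦ norm_nonneg _)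
        (fun n ↦ hinc (n + n₀) (by omega)) ((summable_nat_add_iff n₀).2 hM_sum))
    · -- ### the limit of the partial sums
      have h := ((((hbot0.sub htop0).add (hrgt0.const_mul I)).sub (hlft0.const_mul I)).const_mul
        (2 * Real.pi * I)⁻¹).const_add (G Z)
      simp only [sub_zero, zero_add] at h
      refine (h.congr' ?_)
      filter_upwards [eventually_ge_atTop n₀] with n hn
      rw [hSeq n hn]
  -- ### conclusion: the error term `E` does not depend on `K` and tends to `0`
  obtain ⟨E₀, -, hsum₀, hlim₀⟩ := main K₀ le_rfl
  refine ⟨hsum₀, ?_⟩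
  have hEK : ∀ K, K₀ ≤ K → ‖E₀‖ ≤ ε K := by
    intro K hK
    obtain ⟨E, hE, -, hlim⟩ := main K hK
    have : G Z + E₀ = G Z + E := tendsto_nhds_unique hlim₀ hlim
    rw [add_right_inj] at this
    rw [this]; exact hE
  have hε0 : Tendsto ε atTop (𝓝 0) := by
    have hb : Tendsto bK atTop atTop := by
      refine tendsto_atTop_mono (fun K ↦ ?_) (tendsto_natCast_atTop_atTop.const_mul_atTop two_pos)
      simp only [hbK]; linarith
    have h1 : ∀ w : ℝ, Tendsto (fun K ↦ (π / (bK K - w)) ^ (1 / 2 : ℝ)) atTop (𝓝 0) := by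
      intro w
      have ht : Tendsto (fun K ↦ bK K - w) atTop atTop := tendsto_atTop_add_const_right _ (-w) hb
      have := ((tendsto_const_nhds (x := (π : ℝ))).div_atTop ht).rpow_const (p := (1 / 2 : ℝ))
        (Or.inr (by norm_num))
      simpa [Real.zero_rpow (show (1 / 2 : ℝ) ≠ 0 by norm_num)] using this
    have := ((((h1 Z.re).const_mul (MG ^ (1 / 2 : ℝ))).const_mul (‖riemannZeta Z‖ * Bs)).add
      (((h1 (1 - Z).re).const_mul (MH ^ (1 / 2 : ℝ))).const_mul (‖-riemannZeta Z‖ * Bs))).const_mul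
      (2 * π)⁻¹
    simpa [hεdef] using this
  have hE0 : E₀ = 0 := by
    have h1 : ‖E₀‖ ≤ 0 :=
      le_of_tendsto_of_tendsto tendsto_const_nhds hε0 (eventually_atTop.2 ⟨K₀, hEK⟩)
    exact norm_le_zero_iff.1 h1
  simpa [hE0] using hlim₀

end BurnolResidueSum

end Literature.NumberTheory.LFunctions
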